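import Literature.NumberTheory.Sieve.BombieriFriedlanderIwaniecDispersionS1
import HarnessLib

/-!
# Bombieri–Friedlander–Iwaniec 1986, §8 up to (8.2): `ℛ₁` against the sum `𝒜` of Lemma 6

Topic `Literature/NumberTheory/Sieve`.  Sixth file of the formalisation of the provable part of the
proof of Theorem 1 of E. Bombieri, J. B. Friedlander, H. Iwaniec, *Primes in arithmetic
progressions to large moduli*, Acta Math. 156 (1986), 203–251.  This is §8 "Estimation of `ℛ₁`.
First method" up to (8.2) (p. 226): the remainder `ℛ₁` (6.14) (`BFI.calR1` of `…DispersionS1`)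
is bounded by the square root of BFI's sum `𝒜(4NQ, 2N, 2N/R, H, 2Q)` ((8.2)–(8.3), `BFI.dispA` of
`…Theorem5Reciprocity`), for which Lemma 6 ((8.4), from Lemma 1 = Deshouillers–Iwaniec) is the
only missing input.  Everything here is PROVED; no named facts are introduced.

## Contents (BFI §8, (8.1)–(8.2), p. 226)

* Conjugate pairing `h ↔ −h`: `BFI.fcoef_neg`, `BFI.oscRplus`, `BFI.calR1plus`, `BFI.calR1_eq`
  (`ℛ₁ = ℛ₁⁺ + conj ℛ₁⁺`), `BFI.norm_calR1_le_two_mul`.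
* Partition by `q₀ = (q₁,q₂)`: `BFI.calR1q`, `BFI.calR1plus_eq_sum`; `BFI.lmod_eq_of_gcd`,
  **`BFI.inv_lmod_mul_fcoef_eq`** (separation of variables, "`f̂(h/q₀q₁q₂r) = q₀q₂r ∫ f(ξq₀q₂r)
  e(ξh/q₁) dξ`"), `BFI.Kker` (the `(h,q₁)`-kernel), **`BFI.calR1q_eq_integral`**.
* Change of variables `r ↔ k = (n₂−n₁)/(q₀r)` and `q₁ = q₀q`: `BFI.sum_dyadic_dvd_eq_sum_mul`,
  `BFI.Out` (outer conditions), `BFI.tOut/kOut/sOut`, `BFI.conds_mul_iff` (the conditions of `ℛ₁`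
  split into outer ones, `(q,a)=1`, and the coprimality `(n₁q₂', n₂q) = 1` of `𝒜`),
  **`BFI.e_bfiPhase_eq`** (the phase of `ℛ₁` IS the Kloosterman phase `e(a h k (dq)‾/c)` of `𝒜` at
  `c = n₁q₂'`, `d = n₂`, `q = q₁'`, with `a` replaced by `a·sign(n₁−n₂)`), `BFI.alphaRaw`,
  `BFI.innerAk` (`𝒜 = ∑|innerAk|²`, `BFI.dispA_natCast_eq`), **`BFI.Kker_eq`**.
* Cauchy's inequality: `BFI.yOut`, `BFI.boxA`, `BFI.yOut_mem_boxA`, **`BFI.card_fibre_yOut_le`**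
  (each point of `𝒜` is hit by `≤ τ(c)` outer indices), `BFI.sum_norm_sq_Kker_le`,
  `BFI.sum_sq_weights_le`, `BFI.norm_calR1q_le`, and **`BFI.norm_calR1_le`**:
  `‖ℛ₁‖ ≤ 2(2M+Y)Q₀²/(QR) · √(T_γ²(2Q+1)T_τ‖β‖⁴) · √((T_γ/Q)² T_τ (E₊+E₋))`
  whenever `|γ_q| ≤ T_γ` (`q ∼ Q`), `τ ≤ T_τ` on `[1,4NQ]`, and `𝒜(±a; 4NQ,2N,2N/R,H,2Q; α) ≤ E` for
  all coefficients `|α| ≤ 1` — the shape `x^{o(1)} M Q^{−3/2} R⁻¹ ‖β‖² sup 𝒜^{1/2}` of (8.2).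

## Faithfulness

(8.2) is proved with the supremum over `|α| ≤ 1` realised as a hypothesis `E` on `𝒜` for the two
signs `±a` (the sign of `k = (n₂−n₁)/(q₀r)`; BFI's "`4 ∑`"), the divisor bounds entering through
explicit parameters `T_γ, T_τ` (BFI: `x^ε` by (A₃)), and the `ξ`-integral bounded by the length
`(2M+Y)q₀/(QR)` of the support times the pointwise Cauchy–Schwarz bound (BFI: "with some real ξ").
Lemma 6 itself, the ranges (8.5)–(8.6) and Theorem 1 are assembled downstream.

## References

* E. Bombieri, J. B. Friedlander, H. Iwaniec, Acta Math. 156 (1986), 203–251, §8 (8.1)–(8.3)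
  p. 226; Lemma 6 (8.4) p. 227. [BombieriFriedlanderIwaniecActa1986]
-/

noncomputable section

open Finset Real
open scoped ArithmeticFunction.sigma FourierTransform ComplexConjugate

namespace Literature.NumberTheory.Sieve

namespace BFI

open MeasureTheory
open scoped FourierTransform ComplexConjugate

/-! ### Conjugate pairing of the frequencies `±h` -/

/-- `Φ_k(−h) = conj Φ_k(h)` (the weight is real). [folklore] -/
theorem fcoef_neg (M Y : ℝ) (k : ℕ) (h : ℤ) : fcoef M Y k (-h) = conj (fcoef M Y k h) := by
  rw [fcoef_def, fcoef_def]
  have := FriedlanderIwaniecPrimes.fourier_neg_eq_conj (bump M Y) ((h : ℝ) / k)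
  rw [show (((-h : ℤ) : ℝ) / k) = -((h : ℝ) / k) by push_cast; ring]
  exact this

/-- `bfiPhase (−h) = −bfiPhase h`. [folklore] -/
theorem bfiPhase_neg (a : ℤ) (r q₁ q₂ n₁ n₂ : ℕ) (h : ℤ) :
    bfiPhase a r q₁ q₂ n₁ n₂ (-h) = -bfiPhase a r q₁ q₂ n₁ n₂ h := by
  unfold bfiPhase
  push_cast
  ring

/-- `e(−x) = conj e(x)`. [folklore] -/
theorem e_neg_eq_conj (x : ℝ) : ((𝐞 (-x) : Circle) : ℂ) = conj ((𝐞 x : Circle) : ℂ) := by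
  rw [← Circle.coe_inv_eq_conj, ← AddChar.map_neg_eq_inv]

/-- The positive-frequency half of the `h`-sum of `ℛ₁`. [folklore] -/
def oscRplus (a : ℤ) (M Y : ℝ) (r q₁ q₂ n₁ n₂ : ℕ) (H : ℕ) : ℂ :=
  ∑ h ∈ Finset.Icc 1 H, ((𝐞 (bfiPhase a r q₁ q₂ n₁ n₂ h) : ℂ) * fcoef M Y (lmod r q₁ q₂) h)

/-- `oscR = oscR⁺ + conj oscR⁺`. [folklore] -/
theorem oscR_eq (a : ℤ) (M Y : ℝ) (r q₁ q₂ n₁ n₂ : ℕ) (H : ℕ) :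
    oscR a M Y r q₁ q₂ n₁ n₂ H =
      oscRplus a M Y r q₁ q₂ n₁ n₂ H + conj (oscRplus a M Y r q₁ q₂ n₁ n₂ H) := by
  unfold oscR oscRplus
  rw [map_sum, ← Finset.sum_add_distrib]
  refine Finset.sum_congr rfl fun h _ => ?_
  rw [map_mul, ← fcoef_neg, bfiPhase_neg, e_neg_eq_conj]

open Classical in
/-- The positive-frequency half `ℛ₁⁺` of `ℛ₁`. [folklore] -/
def calR1plus (a : ℤ) (M Y N Q R Q₀ : ℝ) (β γ : ℕ → ℝ) (H : ℕ) : ℂ :=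
  ∑ r ∈ dyadic R, ∑ q₁ ∈ dyadic Q, ∑ q₂ ∈ dyadic Q, ∑ n₁ ∈ dyadic N, ∑ n₂ ∈ dyadic N,
    if Main Q₀ q₁ q₂ n₁ n₂ ∧ Solvable a r q₁ q₂ n₁ n₂ then
      ((γ q₁ * γ q₂ * β n₁ * β n₂ : ℝ) : ℂ) *
        (((lmod r q₁ q₂ : ℂ))⁻¹ * oscRplus a M Y r q₁ q₂ n₁ n₂ H) else 0

/-- `ℛ₁ = ℛ₁⁺ + conj ℛ₁⁺` (pair `h` with `−h`; all coefficients are real). [folklore] -/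
theorem calR1_eq (a : ℤ) (M Y N Q R Q₀ : ℝ) (β γ : ℕ → ℝ) (H : ℕ) :
    calR1 a M Y N Q R Q₀ β γ H =
      calR1plus a M Y N Q R Q₀ β γ H + conj (calR1plus a M Y N Q R Q₀ β γ H) := by
  classical
  unfold calR1 calR1plus
  simp only [map_sum, ← Finset.sum_add_distrib]
  refine Finset.sum_congr rfl fun r _ => Finset.sum_congr rfl fun q₁ _ =>
    Finset.sum_congr rfl fun q₂ _ => Finset.sum_congr rfl fun n₁ _ =>
    Finset.sum_congr rfl fun n₂ _ => ?_
  split_ifs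
  · rw [oscR_eq]
    simp only [map_mul, map_inv₀, map_natCast, Complex.conj_ofReal]
    ring
  · simp

/-- `‖ℛ₁‖ ≤ 2 ‖ℛ₁⁺‖`. [folklore] -/
theorem norm_calR1_le_two_mul (a : ℤ) (M Y N Q R Q₀ : ℝ) (β γ : ℕ → ℝ) (H : ℕ) :
    ‖calR1 a M Y N Q R Q₀ β γ H‖ ≤ 2 * ‖calR1plus a M Y N Q R Q₀ β γ H‖ := by
  rw [calR1_eq]
  refine (norm_add_le _ _).trans (le_of_eq ?_)
  rw [Complex.norm_conj]
  ring

/-! ### Partition by `q₀ = (q₁, q₂)` -/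

open Classical in
/-- `ℛ₁⁺` restricted to `(q₁, q₂) = q₀`. [folklore] -/
def calR1q (a : ℤ) (M Y N Q R Q₀ : ℝ) (β γ : ℕ → ℝ) (H q₀ : ℕ) : ℂ :=
  ∑ r ∈ dyadic R, ∑ q₁ ∈ dyadic Q, ∑ q₂ ∈ dyadic Q, ∑ n₁ ∈ dyadic N, ∑ n₂ ∈ dyadic N,
    if Nat.gcd q₁ q₂ = q₀ ∧ (Main Q₀ q₁ q₂ n₁ n₂ ∧ Solvable a r q₁ q₂ n₁ n₂) then
      ((γ q₁ * γ q₂ * β n₁ * β n₂ : ℝ) : ℂ) *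
        (((lmod r q₁ q₂ : ℂ))⁻¹ * oscRplus a M Y r q₁ q₂ n₁ n₂ H) else 0

/-- `ℛ₁⁺ = ∑_{1 ≤ q₀ ≤ Q₀} ℛ₁⁺(q₀)` (`Q ≥ 0`: then `(q₁,q₂) ≥ 1`). [folklore] -/
theorem calR1plus_eq_sum (a : ℤ) (M Y N : ℝ) {Q : ℝ} (hQ : 0 ≤ Q) (R Q₀ : ℝ) (β γ : ℕ → ℝ)
    (H : ℕ) :
    calR1plus a M Y N Q R Q₀ β γ H =
      ∑ q₀ ∈ Finset.Icc 1 ⌊Q₀⌋₊, calR1q a M Y N Q R Q₀ β γ H q₀ := by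
  classical
  unfold calR1plus calR1q
  symm
  rw [Finset.sum_comm]
  refine Finset.sum_congr rfl fun r _ => ?_
  rw [Finset.sum_comm]
  refine Finset.sum_congr rfl fun q₁ hq₁ => ?_
  rw [Finset.sum_comm]
  refine Finset.sum_congr rfl fun q₂ _ => ?_
  rw [Finset.sum_comm]
  refine Finset.sum_congr rfl fun n₁ _ => ?_
  rw [Finset.sum_comm]
  refine Finset.sum_congr rfl fun n₂ _ => ?_
  -- at most one `q₀` contributes, namely `gcd q₁ q₂`, and it lies in the range iff `gcd ≤ Q₀`
  by_cases h : Main Q₀ q₁ q₂ n₁ n₂ ∧ Solvable a r q₁ q₂ n₁ n₂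
  · rw [if_pos h]
    have hg1 : 1 ≤ Nat.gcd q₁ q₂ := Nat.gcd_pos_of_pos_left _ (pos_of_mem_dyadic hQ hq₁)
    have hgQ : Nat.gcd q₁ q₂ ≤ ⌊Q₀⌋₊ := Nat.le_floor h.1.2
    rw [Finset.sum_eq_single_of_mem (Nat.gcd q₁ q₂) (Finset.mem_Icc.2 ⟨hg1, hgQ⟩)]
    · rw [if_pos ⟨rfl, h⟩]
    · intro q₀ _ hne
      rw [if_neg (fun h' => hne h'.1.symm)]
  · rw [if_neg h]
    refine Finset.sum_eq_zero fun q₀ _ => ?_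
    rw [if_neg (fun h' => h h'.2)]

/-! ### `L` and `Φ_L` when `(q₁, q₂) = q₀` -/

/-- For `(q₁, q₂) = q₀`: `L = q₁ · ((q₂/q₀) r)`. [folklore] -/
theorem lmod_eq_of_gcd {q₁ q₂ q₀ : ℕ} (hg : Nat.gcd q₁ q₂ = q₀) (r : ℕ) :
    lmod r q₁ q₂ = (q₂ / q₀ * r) * q₁ := by
  unfold lmod
  subst hg
  rw [Nat.lcm, Nat.mul_div_assoc _ (Nat.gcd_dvd_right q₁ q₂)]
  ring

/-- **Separation of variables for `Φ_L(h)/L`** (BFI p. 226: "we first compute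
`f̂(h/q₀q₁q₂r) = q₀q₂r ∫ f(ξq₀q₂r) e(ξh/q₁) dξ`"): for `(q₁,q₂) = q₀`, `q₁, q₂, r ≥ 1`, with
`e = (q₂/q₀) r`,  `L⁻¹ Φ_L(h) = q₁⁻¹ ∫ e(−ξh/q₁) f_ℂ(e ξ) dξ`.
[cite: BombieriFriedlanderIwaniecActa1986, §8 p. 226] -/
theorem inv_lmod_mul_fcoef_eq {M Y : ℝ} {r q₁ q₂ q₀ : ℕ} (hr : 0 < r) (hq₁ : 0 < q₁) (hq₂ : 0 < q₂)
    (hg : Nat.gcd q₁ q₂ = q₀) (h : ℤ) :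
    ((lmod r q₁ q₂ : ℂ))⁻¹ * fcoef M Y (lmod r q₁ q₂) h =
      ((q₁ : ℂ))⁻¹ * ∫ ξ : ℝ, (𝐞 (-(ξ * h / q₁)) : ℂ) * bumpC M Y ((q₂ / q₀ * r : ℕ) * ξ) := by
  have hq₀ : 0 < q₀ := by rw [← hg]; exact Nat.gcd_pos_of_pos_left _ hq₁
  have hq₀dvd : q₀ ∣ q₂ := by rw [← hg]; exact Nat.gcd_dvd_right _ _
  have he : 0 < q₂ / q₀ * r := Nat.mul_pos (Nat.div_pos (Nat.le_of_dvd hq₂ hq₀dvd) hq₀) hr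
  rw [lmod_eq_of_gcd hg r, fcoef_mul_eq_integral M Y he q₁ h]
  set I := ∫ ξ : ℝ, (𝐞 (-(ξ * h / q₁)) : ℂ) * bumpC M Y ((q₂ / q₀ * r : ℕ) * ξ) with hI
  have he0 : ((q₂ / q₀ * r : ℕ) : ℂ) ≠ 0 := by exact_mod_cast he.ne'
  have hq₁0 : (q₁ : ℂ) ≠ 0 := by exact_mod_cast hq₁.ne'
  rw [Nat.cast_mul]
  field_simp


/-! ### `ℛ₁⁺(q₀)` as an integral against `f(e ξ)` with the `(h, q₁)`-kernel -/

open Classical in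
/-- The `(h, q₁)`-kernel of `ℛ₁⁺(q₀)` at the outer index `(r, q₂, n₁, n₂)` and the point `ξ`:
`∑_{1≤h≤H} ∑_{q₁∼Q, (q₁,q₂)=q₀, main, solvable} (γ_{q₁}/q₁) e(−ξh/q₁) e(bfiPhase h)` (the sum inside
`|…|` in the display before (8.2), p. 226). [cite: BombieriFriedlanderIwaniecActa1986, §8 p. 226] -/
def Kker (a : ℤ) (Q Q₀ : ℝ) (γ : ℕ → ℝ) (q₀ H : ℕ) (ξ : ℝ) (r q₂ n₁ n₂ : ℕ) : ℂ :=
  ∑ h ∈ Finset.Icc 1 H, ∑ q₁ ∈ dyadic Q,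
    if Nat.gcd q₁ q₂ = q₀ ∧ (Main Q₀ q₁ q₂ n₁ n₂ ∧ Solvable a r q₁ q₂ n₁ n₂) then
      ((γ q₁ / q₁ : ℝ) : ℂ) * (𝐞 (-(ξ * h / q₁)) : ℂ) * (𝐞 (bfiPhase a r q₁ q₂ n₁ n₂ h) : ℂ)
    else 0

open Classical in
/-- The summand of the kernel, as a function of `ξ`, is continuous. [folklore] -/
theorem continuous_Kker_term (a : ℤ) (Q₀ : ℝ) (γ : ℕ → ℝ) (q₀ : ℕ) (r q₂ n₁ n₂ h q₁ : ℕ) :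
    Continuous fun ξ : ℝ =>
      (if Nat.gcd q₁ q₂ = q₀ ∧ (Main Q₀ q₁ q₂ n₁ n₂ ∧ Solvable a r q₁ q₂ n₁ n₂) then
        ((γ q₁ / q₁ : ℝ) : ℂ) * (𝐞 (-(ξ * h / q₁)) : ℂ) * (𝐞 (bfiPhase a r q₁ q₂ n₁ n₂ h) : ℂ)
      else 0 : ℂ) := by
  split_ifs
  · exact (continuous_const.mul (continuous_e_comp (by fun_prop))).mul continuous_const
  · exact continuous_const

open Classical in
/-- **`ℛ₁⁺(q₀)` in integral form** (BFI §8, the display before (8.2), p. 226: "In order to separate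
the variables `h, q₁` from the remaining ones we first compute `f̂(h/q₀q₁q₂r) = q₀q₂r ∫ f(ξq₀q₂r)
e(ξh/q₁) dξ` … it follows that `|ℛ₁| ≤ 4 ∑_{q₀} ∑_k ∑_{q₂} |γ| ∑ |ββ| ∫ f(ξq₀q₂r) |∑_h ∑_{q₁} …| dξ`"),
before taking absolute values: for `0 < Y ≤ M`, `Q, R ≥ 0`, `q₀ ≥ 1`,
`ℛ₁⁺(q₀) = ∑_{r,q₂,n₁,n₂} γ_{q₂} β_{n₁} β_{n₂} ∫ f_ℂ(e ξ) K(ξ; r,q₂,n₁,n₂) dξ`, `e = (q₂/q₀) r`.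
[cite: BombieriFriedlanderIwaniecActa1986, §8 (8.1)–(8.2) p. 226] -/
theorem calR1q_eq_integral {a : ℤ} {M Y : ℝ} (hY : 0 < Y) (hYM : Y ≤ M) (N : ℝ) {Q R : ℝ}
    (hQ : 0 ≤ Q) (hR : 0 ≤ R) (Q₀ : ℝ) (β γ : ℕ → ℝ) (H : ℕ) {q₀ : ℕ} (hq₀ : 0 < q₀) :
    calR1q a M Y N Q R Q₀ β γ H q₀ =
      ∑ r ∈ dyadic R, ∑ q₂ ∈ dyadic Q, ∑ n₁ ∈ dyadic N, ∑ n₂ ∈ dyadic N,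
        ((γ q₂ * β n₁ * β n₂ : ℝ) : ℂ) *
          ∫ ξ : ℝ, bumpC M Y ((q₂ / q₀ * r : ℕ) * ξ) * Kker a Q Q₀ γ q₀ H ξ r q₂ n₁ n₂ := by
  have hM : 0 ≤ M := hY.le.trans hYM
  unfold calR1q
  refine Finset.sum_congr rfl fun r hr => ?_
  rw [Finset.sum_comm]
  refine Finset.sum_congr rfl fun q₂ hq₂ => ?_
  rw [Finset.sum_comm]
  refine Finset.sum_congr rfl fun n₁ _ => ?_
  rw [Finset.sum_comm]
  refine Finset.sum_congr rfl fun n₂ _ => ?_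
  have hr0 := pos_of_mem_dyadic hR hr
  have hq₂0 := pos_of_mem_dyadic hQ hq₂
  -- the summand of `K` as a function of `(q₁, h, ξ)`
  set X : ℕ → ℕ → ℝ → ℂ := fun q₁ h ξ =>
    if Nat.gcd q₁ q₂ = q₀ ∧ (Main Q₀ q₁ q₂ n₁ n₂ ∧ Solvable a r q₁ q₂ n₁ n₂) then
      ((γ q₁ / q₁ : ℝ) : ℂ) * (𝐞 (-(ξ * h / q₁)) : ℂ) * (𝐞 (bfiPhase a r q₁ q₂ n₁ n₂ h) : ℂ)
    else 0 with hX
  have hXcont : ∀ q₁ h, Continuous (X q₁ h) := fun q₁ h =>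
    continuous_Kker_term a Q₀ γ q₀ r q₂ n₁ n₂ h q₁
  by_cases hdvd : q₀ ∣ q₂
  · have he : 0 < q₂ / q₀ * r := Nat.mul_pos (Nat.div_pos (Nat.le_of_dvd hq₂0 hdvd) hq₀) hr0
    obtain ⟨hcont, hsupp⟩ := continuous_hasCompactSupport_bumpC_comp hY hM he
    have hint : ∀ q₁ h, Integrable (fun ξ : ℝ => bumpC M Y ((q₂ / q₀ * r : ℕ) * ξ) * X q₁ h ξ) :=
      fun q₁ h => (hcont.mul (hXcont q₁ h)).integrable_of_hasCompactSupport hsupp.mul_right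
    -- the scalar identity for each `(q₁, h)`
    have hscal : ∀ q₁ ∈ dyadic Q, ∀ h : ℕ,
        (if Nat.gcd q₁ q₂ = q₀ ∧ (Main Q₀ q₁ q₂ n₁ n₂ ∧ Solvable a r q₁ q₂ n₁ n₂) then
          ((γ q₁ * γ q₂ * β n₁ * β n₂ : ℝ) : ℂ) * (((lmod r q₁ q₂ : ℂ))⁻¹ *
            ((𝐞 (bfiPhase a r q₁ q₂ n₁ n₂ h) : ℂ) * fcoef M Y (lmod r q₁ q₂) h)) else 0) =
        ((γ q₂ * β n₁ * β n₂ : ℝ) : ℂ) * ∫ ξ : ℝ, bumpC M Y ((q₂ / q₀ * r : ℕ) * ξ) * X q₁ h ξ := by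
      intro q₁ hq₁ h
      have hq₁0 := pos_of_mem_dyadic hQ hq₁
      by_cases hP : Nat.gcd q₁ q₂ = q₀ ∧ (Main Q₀ q₁ q₂ n₁ n₂ ∧ Solvable a r q₁ q₂ n₁ n₂)
      · rw [if_pos hP]
        have hsep := inv_lmod_mul_fcoef_eq (M := M) (Y := Y) hr0 hq₁0 hq₂0 hP.1 (h : ℤ)
        set E₁ : ℂ := (𝐞 (bfiPhase a r q₁ q₂ n₁ n₂ h) : ℂ) with hE₁
        rw [show (((lmod r q₁ q₂ : ℂ))⁻¹ * (E₁ * fcoef M Y (lmod r q₁ q₂) h)) =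
          E₁ * ((((lmod r q₁ q₂ : ℂ))⁻¹ * fcoef M Y (lmod r q₁ q₂) h)) by ring, hsep]
        set I : ℂ := ∫ ξ : ℝ, (𝐞 (-(ξ * (h : ℤ) / q₁)) : ℂ) * bumpC M Y ((q₂ / q₀ * r : ℕ) * ξ)
          with hI
        rw [show ((γ q₁ * γ q₂ * β n₁ * β n₂ : ℝ) : ℂ) * (E₁ * (((q₁ : ℂ))⁻¹ * I)) =
          (((γ q₁ * γ q₂ * β n₁ * β n₂ : ℝ) : ℂ) * E₁ * ((q₁ : ℂ))⁻¹) * I by ring]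
        rw [hI, ← integral_const_mul, ← integral_const_mul]
        refine integral_congr_ae (Filter.Eventually.of_forall fun ξ => ?_)
        simp only [hX, if_pos hP, hE₁]
        push_cast
        ring
      · rw [if_neg hP]
        symm
        rw [mul_eq_zero]
        right
        refine (integral_congr_ae (Filter.Eventually.of_forall fun ξ => ?_)).trans (integral_zero ℝ ℂ)
        simp only [hX, if_neg hP, mul_zero]
    -- rearrange
    unfold oscRplus
    calc ∑ q₁ ∈ dyadic Q,
          (if Nat.gcd q₁ q₂ = q₀ ∧ (Main Q₀ q₁ q₂ n₁ n₂ ∧ Solvable a r q₁ q₂ n₁ n₂) then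
            ((γ q₁ * γ q₂ * β n₁ * β n₂ : ℝ) : ℂ) * (((lmod r q₁ q₂ : ℂ))⁻¹ *
              ∑ h ∈ Finset.Icc 1 H,
                (𝐞 (bfiPhase a r q₁ q₂ n₁ n₂ h) : ℂ) * fcoef M Y (lmod r q₁ q₂) h) else 0)
        = ∑ q₁ ∈ dyadic Q, ∑ h ∈ Finset.Icc 1 H,
            ((γ q₂ * β n₁ * β n₂ : ℝ) : ℂ) *
              ∫ ξ : ℝ, bumpC M Y ((q₂ / q₀ * r : ℕ) * ξ) * X q₁ h ξ := by
          refine Finset.sum_congr rfl fun q₁ hq₁ => ?_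
          by_cases hP : Nat.gcd q₁ q₂ = q₀ ∧ (Main Q₀ q₁ q₂ n₁ n₂ ∧ Solvable a r q₁ q₂ n₁ n₂)
          · rw [if_pos hP, Finset.mul_sum, Finset.mul_sum]
            refine Finset.sum_congr rfl fun h _ => ?_
            rw [← hscal q₁ hq₁ h, if_pos hP]
          · rw [if_neg hP]
            symm
            refine Finset.sum_eq_zero fun h _ => ?_
            rw [← hscal q₁ hq₁ h, if_neg hP]
      _ = ((γ q₂ * β n₁ * β n₂ : ℝ) : ℂ) * ∑ q₁ ∈ dyadic Q, ∑ h ∈ Finset.Icc 1 H,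
            ∫ ξ : ℝ, bumpC M Y ((q₂ / q₀ * r : ℕ) * ξ) * X q₁ h ξ := by
          rw [Finset.mul_sum]
          refine Finset.sum_congr rfl fun q₁ _ => ?_
          rw [Finset.mul_sum]
      _ = ((γ q₂ * β n₁ * β n₂ : ℝ) : ℂ) *
            ∫ ξ : ℝ, bumpC M Y ((q₂ / q₀ * r : ℕ) * ξ) * Kker a Q Q₀ γ q₀ H ξ r q₂ n₁ n₂ := by
          congr 1
          have e1 : ∫ ξ : ℝ, bumpC M Y ((q₂ / q₀ * r : ℕ) * ξ) * Kker a Q Q₀ γ q₀ H ξ r q₂ n₁ n₂ =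
              ∫ ξ : ℝ, ∑ q₁ ∈ dyadic Q, ∑ h ∈ Finset.Icc 1 H,
                bumpC M Y ((q₂ / q₀ * r : ℕ) * ξ) * X q₁ h ξ := by
            refine integral_congr_ae (Filter.Eventually.of_forall fun ξ => ?_)
            simp only [Kker, hX, Finset.mul_sum]
            rw [Finset.sum_comm]
          rw [e1, integral_finsetSum _ fun q₁ _ => integrable_finsetSum _ fun h _ => hint q₁ h]
          refine Finset.sum_congr rfl fun q₁ _ => ?_
          rw [integral_finsetSum _ fun h _ => hint q₁ h]
  · -- `q₀ ∤ q₂`: no `q₁` has `(q₁, q₂) = q₀`, both sides vanish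
    have hnone : ∀ q₁, ¬(Nat.gcd q₁ q₂ = q₀ ∧ (Main Q₀ q₁ q₂ n₁ n₂ ∧ Solvable a r q₁ q₂ n₁ n₂)) := by
      intro q₁ hP
      exact hdvd (hP.1 ▸ Nat.gcd_dvd_right q₁ q₂)
    rw [Finset.sum_eq_zero fun q₁ _ => if_neg (hnone q₁)]
    symm
    rw [mul_eq_zero]
    right
    refine (integral_congr_ae (Filter.Eventually.of_forall fun ξ => ?_)).trans (integral_zero ℝ ℂ)
    simp only [Kker]
    rw [Finset.sum_eq_zero fun h _ => Finset.sum_eq_zero fun q₁ _ => if_neg (hnone q₁), mul_zero]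


/-! ### Reindexing `q₁ = q₀ q` -/

/-- For `q₀ ≥ 1`, `Q ≥ 0`: `∑_{q₁∼Q, q₀∣q₁} F(q₁) = ∑_{1≤q≤2Q, q₀q∼Q} F(q₀q)`. [folklore] -/
theorem sum_dyadic_dvd_eq_sum_mul {Q : ℝ} (hQ : 0 ≤ Q) {q₀ : ℕ} (hq₀ : 0 < q₀) (F : ℕ → ℂ) :
    ∑ q₁ ∈ dyadic Q, (if q₀ ∣ q₁ then F q₁ else 0) =
      ∑ q ∈ Finset.Icc 1 ⌊2 * Q⌋₊, (if q₀ * q ∈ dyadic Q then F (q₀ * q) else 0) := by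
  rw [← Finset.sum_filter, ← Finset.sum_filter]
  refine Finset.sum_nbij' (fun q₁ => q₁ / q₀) (fun q => q₀ * q) ?_ ?_ ?_ ?_ ?_
  · intro q₁ hq₁
    rw [Finset.mem_filter] at hq₁ ⊢
    obtain ⟨hmem, hdvd⟩ := hq₁
    have h1 := (mem_dyadic hQ).1 hmem
    have hq₁0 : 0 < q₁ := pos_of_mem_dyadic hQ hmem
    rw [Nat.mul_div_cancel' hdvd]
    refine ⟨Finset.mem_Icc.2 ⟨?_, ?_⟩, hmem⟩
    · exact Nat.div_pos (Nat.le_of_dvd hq₁0 hdvd) hq₀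
    · refine (Nat.div_le_self _ _).trans (Nat.le_floor ?_)
      exact h1.2
  · intro q hq
    rw [Finset.mem_filter] at hq ⊢
    exact ⟨hq.2, Dvd.intro q rfl⟩
  · intro q₁ hq₁
    rw [Finset.mem_filter] at hq₁
    exact Nat.mul_div_cancel' hq₁.2
  · intro q _
    exact Nat.mul_div_cancel_left q hq₀
  · intro q₁ hq₁
    rw [Finset.mem_filter] at hq₁
    rw [Nat.mul_div_cancel' hq₁.2]

/-! ### The outer conditions and the data `(c, d, k, sign)` of an outer index -/

/-- The conditions on the outer index `(r, q₂, n₁, n₂)` (for fixed `q₀`) under which the kernel does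
not vanish: `q₀ ∣ q₂`, `(n₁,n₂) = 1`, `n₁ ≠ n₂`, `(q₀, a) = (q₂r, a) = 1`, `(n₁, q₀r) = (n₂, q₂r) = 1`,
`n₁ ≡ n₂ (q₀ r)`. [cite: BombieriFriedlanderIwaniecActa1986, §8 p. 226] -/
abbrev Out (a : ℤ) (q₀ r q₂ n₁ n₂ : ℕ) : Prop :=
  q₀ ∣ q₂ ∧ n₁.Coprime n₂ ∧ n₁ ≠ n₂ ∧ IsCoprime (q₀ : ℤ) a ∧ IsCoprime ((q₂ * r : ℕ) : ℤ) a ∧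
    n₁.Coprime (q₀ * r) ∧ n₂.Coprime (q₂ * r) ∧ (n₁ : ZMod (q₀ * r)) = (n₂ : ZMod (q₀ * r))

/-- The integer `t = (n₁ − n₂)/(q₀ r)` of the outer index. [folklore] -/
def tOut (q₀ r n₁ n₂ : ℕ) : ℤ := ((n₁ : ℤ) - n₂) / ((q₀ * r : ℕ) : ℤ)

/-- `k = |t|` (BFI's `k = (n₂ − n₁)/(q₀r)`, `1 ≤ |k| ≤ K`, p. 226). [cite: BombieriFriedlanderIwaniecActa1986, §8 p. 226] -/
def kOut (q₀ r n₁ n₂ : ℕ) : ℕ := (tOut q₀ r n₁ n₂).natAbs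

/-- The sign of `t`. [folklore] -/
def sOut (q₀ r n₁ n₂ : ℕ) : ℤ := (tOut q₀ r n₁ n₂).sign

/-- Under `Out`: `n₁ − n₂ = q₀ r t`, `t ≠ 0`, `t = sign · k`. [folklore] -/
theorem tOut_facts {a : ℤ} {q₀ r q₂ n₁ n₂ : ℕ} (h : Out a q₀ r q₂ n₁ n₂) :
    ((n₁ : ℤ) - n₂) = ((q₀ * r : ℕ) : ℤ) * tOut q₀ r n₁ n₂ ∧ tOut q₀ r n₁ n₂ ≠ 0 ∧
      tOut q₀ r n₁ n₂ = sOut q₀ r n₁ n₂ * (kOut q₀ r n₁ n₂ : ℤ) := by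
  obtain ⟨_, _, hne, _, _, _, _, hcong⟩ := h
  have hdvd : ((q₀ * r : ℕ) : ℤ) ∣ ((n₁ : ℤ) - n₂) := by
    rw [← ZMod.intCast_eq_intCast_iff_dvd_sub]
    push_cast
    exact hcong.symm
  have e : ((n₁ : ℤ) - n₂) = ((q₀ * r : ℕ) : ℤ) * tOut q₀ r n₁ n₂ := by
    unfold tOut
    rw [Int.mul_ediv_cancel' hdvd]
  refine ⟨e, ?_, ?_⟩
  · intro h0
    rw [h0, mul_zero, sub_eq_zero] at e
    exact hne (by exact_mod_cast e)
  · unfold sOut kOut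
    rw [Int.natCast_natAbs, Int.sign_mul_abs]

/-- `uNat` and `bfiPhase` computed with a name for `(q₁, q₂)`. [folklore] -/
theorem uNat_eq_of_gcd {q₁ q₂ g : ℕ} (hg : Nat.gcd q₁ q₂ = g) (n₁ n₂ : ℕ) :
    uNat q₁ q₂ n₁ n₂ = (((n₂ * (q₁ / g) : ℕ) : ZMod (n₁ * (q₂ / g)))⁻¹).val := by
  subst hg
  rfl

/-- `bfiPhase` computed with a name for `(q₁, q₂)`. [folklore] -/
theorem bfiPhase_eq_of_gcd (a : ℤ) {r q₁ q₂ g : ℕ} (hg : Nat.gcd q₁ q₂ = g) (n₁ n₂ : ℕ) (h : ℤ) :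
    bfiPhase a r q₁ q₂ n₁ n₂ h =
      (h : ℝ) * a * ((((n₁ : ℤ) - n₂) / ((g * r : ℕ) : ℤ) : ℤ) : ℝ) *
        ((((n₂ * (q₁ / g) : ℕ) : ZMod (n₁ * (q₂ / g)))⁻¹).val : ℝ) / ((n₁ : ℝ) * (q₂ / g : ℕ)) := by
  subst hg
  rfl


/-- A congruence modulo `m` transported along `m = m'`. [folklore] -/
theorem zmod_natCast_eq_iff_of_eq {m m' : ℕ} (h : m = m') (x y : ℕ) :
    (x : ZMod m) = (y : ZMod m) ↔ (x : ZMod m') = (y : ZMod m') := by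
  subst h
  exact Iff.rfl

/-- **The conditions of `ℛ₁` in the variables of `𝒜`**: for `q₀, r, q₂, q ≥ 1`, `n₁ ≥ 2`, `q₀ ≤ Q₀`,
the condition `(q₀q, q₂) = q₀ ∧ main ∧ solvable` at `q₁ = q₀ q` splits into the outer conditions
`Out`, the inner condition `(q, a) = 1`, and the coprimality `(n₁q₂', n₂q) = 1` of `𝒜` (BFI p. 226:
"`(q₀k, n₁n₂) = 1`, … `(q₁, an₁q₂) = 1`"). [cite: BombieriFriedlanderIwaniecActa1986, §8 p. 226] -/
theorem conds_mul_iff {a : ℤ} {Q₀ : ℝ} {q₀ r q₂ n₁ n₂ q : ℕ} (hq₀ : 0 < q₀) (hq₀Q : (q₀ : ℝ) ≤ Q₀)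
    (hr : 0 < r) (hq₂ : 0 < q₂) (hn₁ : 1 < n₁) (hq : 0 < q) :
    (Nat.gcd (q₀ * q) q₂ = q₀ ∧ (Main Q₀ (q₀ * q) q₂ n₁ n₂ ∧ Solvable a r (q₀ * q) q₂ n₁ n₂)) ↔
      (Out a q₀ r q₂ n₁ n₂ ∧ IsCoprime (q : ℤ) a ∧ (n₁ * (q₂ / q₀)).Coprime (n₂ * q)) := by
  have hq₁ : 0 < q₀ * q := Nat.mul_pos hq₀ hq
  rw [solvable_iff hr hq₁ hq₂]
  constructor
  · rintro ⟨hg, ⟨hcop, _⟩, hka, hn₁c, hn₂c, hcong⟩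
    have hdvd : q₀ ∣ q₂ := hg ▸ Nat.gcd_dvd_right _ _
    have e2 : q₂ = q₀ * (q₂ / q₀) := (Nat.mul_div_cancel' hdvd).symm
    have hka' : IsCoprime ((q₀ : ℤ) * q * (q₂ * r)) a := by
      have : ((q₀ * q * q₂ * r : ℕ) : ℤ) = (q₀ : ℤ) * q * (q₂ * r) := by push_cast; ring
      rwa [this] at hka
    have hne : n₁ ≠ n₂ := by
      intro h
      rw [← h] at hcop
      have := (Nat.coprime_self n₁).1 hcop
      omega
    have hcong' : (n₁ : ZMod (q₀ * r)) = (n₂ : ZMod (q₀ * r)) := by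
      have e : gmod r (q₀ * q) q₂ = q₀ * r := by unfold gmod; rw [hg]
      exact (zmod_natCast_eq_iff_of_eq e n₁ n₂).1 hcong
    have hq₂'q : (q₂ / q₀).Coprime q := by
      have h1 : Nat.gcd (q₀ * q) (q₀ * (q₂ / q₀)) = q₀ * Nat.gcd q (q₂ / q₀) := Nat.gcd_mul_left _ _ _
      rw [← e2, hg] at h1
      have h2 : Nat.gcd q (q₂ / q₀) = 1 := by
        have h3 : q₀ * Nat.gcd q (q₂ / q₀) = q₀ * 1 := by rw [mul_one]; exact h1.symm
        exact Nat.eq_of_mul_eq_mul_left hq₀ h3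
      exact Nat.Coprime.symm h2
    refine ⟨⟨hdvd, hcop, hne, ?_, ?_, ?_, hn₂c, hcong'⟩, ?_, ?_⟩
    · exact IsCoprime.of_mul_left_left (IsCoprime.of_mul_left_left hka')
    · have := IsCoprime.of_mul_left_right hka'
      have e : (q₂ : ℤ) * r = ((q₂ * r : ℕ) : ℤ) := by push_cast; ring
      rwa [e] at this
    · exact Nat.Coprime.coprime_dvd_right ⟨q, by ring⟩ hn₁c
    · exact IsCoprime.of_mul_left_right (IsCoprime.of_mul_left_left hka')
    · have hn₁q : n₁.Coprime q := Nat.Coprime.coprime_dvd_right ⟨q₀ * r, by ring⟩ hn₁c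
      have hq₂'n₂ : (q₂ / q₀).Coprime n₂ :=
        (Nat.Coprime.coprime_dvd_right ((Nat.div_dvd_of_dvd hdvd).trans (dvd_mul_right q₂ r)) hn₂c).symm
      exact Nat.Coprime.mul_left (Nat.Coprime.mul_right hcop hn₁q)
        (Nat.Coprime.mul_right hq₂'n₂ hq₂'q)
  · rintro ⟨⟨hdvd, hcop, hne, hq₀a, hq₂ra, hn₁g, hn₂c, hcong⟩, hqa, hfil⟩
    have e2 : q₂ = q₀ * (q₂ / q₀) := (Nat.mul_div_cancel' hdvd).symm
    have hq₂'q : (q₂ / q₀).Coprime q := by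
      have := Nat.Coprime.coprime_dvd_left (dvd_mul_left (q₂ / q₀) n₁) hfil
      exact Nat.Coprime.coprime_dvd_right (dvd_mul_left q n₂) this
    have hg : Nat.gcd (q₀ * q) q₂ = q₀ := by
      conv_lhs => rw [e2]
      rw [Nat.gcd_mul_left, Nat.Coprime.gcd_eq_one hq₂'q.symm, mul_one]
    have hn₁q : n₁.Coprime q := by
      have := Nat.Coprime.coprime_dvd_left (dvd_mul_right n₁ (q₂ / q₀)) hfil
      exact Nat.Coprime.coprime_dvd_right (dvd_mul_left q n₂) this
    refine ⟨hg, ⟨hcop, by rw [hg]; exact hq₀Q⟩, ?_, ?_, hn₂c, ?_⟩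
    · have h1 : IsCoprime ((q₀ : ℤ) * q * (q₂ * r)) a := by
        refine IsCoprime.mul_left (IsCoprime.mul_left hq₀a hqa) ?_
        have e : (q₂ : ℤ) * r = ((q₂ * r : ℕ) : ℤ) := by push_cast; ring
        rw [e]; exact hq₂ra
      have : ((q₀ * q * q₂ * r : ℕ) : ℤ) = (q₀ : ℤ) * q * (q₂ * r) := by push_cast; ring
      rwa [this]
    · have : n₁.Coprime (q * (q₀ * r)) := Nat.Coprime.mul_right hn₁q hn₁g
      have e : q₀ * q * r = q * (q₀ * r) := by ring
      rwa [e]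
    · have e : gmod r (q₀ * q) q₂ = q₀ * r := by unfold gmod; rw [hg]
      exact (zmod_natCast_eq_iff_of_eq e n₁ n₂).2 hcong


/-! ### The phase of `ℛ₁` is the Kloosterman phase of `𝒜` -/

/-- `e(x + n) = e(x)` for an integer `n`. [folklore] -/
theorem e_add_intCast (x : ℝ) (n : ℤ) : ((𝐞 (x + n) : Circle) : ℂ) = ((𝐞 x : Circle) : ℂ) := by
  rw [AddChar.map_add_eq_mul, Circle.coe_mul, e_intCast, mul_one]

/-- **The phase of `ℛ₁` in the variables of `𝒜`** (BFI (8.2): the phase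
`e(ahk (n₂q₁)‾/(n₁q₂))` of `𝒜(C,D,K,H,Q)` at `c = n₁q₂'`, `d = n₂`, `q = q₁'`): under the outer
conditions, at `q₁ = q₀q` with `(q₀q, q₂) = q₀`,
`e(bfiPhase h) = e(ρ h k/c)` with `c = n₁ q₂'`, `k = |t|`, `ρ = ((a·sign t) (n₂q)⁻¹ mod c)`.
[cite: BombieriFriedlanderIwaniecActa1986, §8 (8.2) p. 226] -/
theorem e_bfiPhase_eq {a : ℤ} {q₀ r q₂ n₁ n₂ q : ℕ} (hq₀ : 0 < q₀) (hq₂ : 0 < q₂) (hn₁ : 0 < n₁)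
    (hOut : Out a q₀ r q₂ n₁ n₂) (hg : Nat.gcd (q₀ * q) q₂ = q₀) (h : ℕ) :
    ((𝐞 (bfiPhase a r (q₀ * q) q₂ n₁ n₂ h) : Circle) : ℂ) =
      𝐞 ((((((a * sOut q₀ r n₁ n₂ : ℤ) : ZMod (n₁ * (q₂ / q₀))) *
            (((n₂ * q : ℕ) : ZMod (n₁ * (q₂ / q₀))))⁻¹).val : ℕ) : ℝ) * h *
          (kOut q₀ r n₁ n₂) / ((n₁ * (q₂ / q₀) : ℕ) : ℝ)) := by
  obtain ⟨ht, ht0, hts⟩ := tOut_facts hOut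
  have hdvd : q₀ ∣ q₂ := hOut.1
  have hq₂' : 0 < q₂ / q₀ := Nat.div_pos (Nat.le_of_dvd hq₂ hdvd) hq₀
  have hc : 0 < n₁ * (q₂ / q₀) := Nat.mul_pos hn₁ hq₂'
  haveI : NeZero (n₁ * (q₂ / q₀)) := ⟨hc.ne'⟩
  rw [bfiPhase_eq_of_gcd a hg n₁ n₂ h, Nat.mul_div_cancel_left q hq₀]
  -- names
  set c : ℕ := n₁ * (q₂ / q₀) with hcdef
  set U : ℕ := ((((n₂ * q : ℕ) : ZMod c))⁻¹).val with hU
  set ρ : ℕ := (((a * sOut q₀ r n₁ n₂ : ℤ) : ZMod c) * (((n₂ * q : ℕ) : ZMod c))⁻¹).val with hρ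
  have hT : ((((n₁ : ℤ) - n₂) / ((q₀ * r : ℕ) : ℤ) : ℤ) : ℝ) =
      (sOut q₀ r n₁ n₂ : ℝ) * (kOut q₀ r n₁ n₂ : ℝ) := by
    have : (((n₁ : ℤ) - n₂) / ((q₀ * r : ℕ) : ℤ)) = tOut q₀ r n₁ n₂ := rfl
    rw [this, hts]
    push_cast
    ring
  -- `a s U ≡ ρ (mod c)`
  have hmod : (c : ℤ) ∣ (ρ : ℤ) - a * sOut q₀ r n₁ n₂ * U := by
    rw [← ZMod.intCast_eq_intCast_iff_dvd_sub]
    push_cast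
    rw [hρ, hU, ZMod.natCast_zmod_val, ZMod.natCast_zmod_val]
    push_cast
    ring
  obtain ⟨m, hm⟩ := hmod
  have hcR : (0 : ℝ) < (c : ℝ) := by exact_mod_cast hc
  have hcR' : ((n₁ : ℝ) * (q₂ / q₀ : ℕ)) = (c : ℝ) := by rw [hcdef]; push_cast; ring
  have hcR'' : ((n₁ * (q₂ / q₀) : ℕ) : ℝ) = (c : ℝ) := by rw [hcdef]
  have key : (h : ℝ) * a * ((sOut q₀ r n₁ n₂ : ℝ) * (kOut q₀ r n₁ n₂ : ℝ)) * (U : ℝ) / (c : ℝ) =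
      (ρ : ℝ) * h * (kOut q₀ r n₁ n₂) / (c : ℝ) + ((-(h * (kOut q₀ r n₁ n₂ : ℤ) * m) : ℤ) : ℝ) := by
    have hmR : (ρ : ℝ) - a * (sOut q₀ r n₁ n₂ : ℝ) * U = (c : ℝ) * m := by exact_mod_cast hm
    field_simp
    push_cast
    linear_combination (-(h : ℝ) * (kOut q₀ r n₁ n₂ : ℝ)) * hmR
  rw [hT]
  push_cast
  rw [hcR', hcR'', key, e_add_intCast]

/-! ### The kernel as the inner sum of `𝒜` -/

/-- The coefficients `α_ξ(h, q)` of §8 before normalisation: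
`[q₀q ∼ Q][(q,a)=1] γ_{q₀q}/(q₀q) · e(−ξh/(q₀q))`. [cite: BombieriFriedlanderIwaniecActa1986, §8 (8.2)–(8.3) p. 226] -/
def alphaRaw (a : ℤ) (Q : ℝ) (γ : ℕ → ℝ) (q₀ : ℕ) (ξ : ℝ) (h q : ℕ) : ℂ :=
  if q₀ * q ∈ dyadic Q ∧ IsCoprime (q : ℤ) a then
    ((γ (q₀ * q) / (q₀ * q : ℕ) : ℝ) : ℂ) * (𝐞 (-(ξ * h / (q₀ * q : ℕ))) : ℂ)
  else 0

/-- The inner double sum of BFI's `𝒜(C, D, K, H, Q)` ((8.2)–(8.3)) at `(c, d, k)`: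
`∑_{1≤h≤H} ∑_{q≤Q', (c, dq)=1} α(h,q) e((a (dq)‾ mod c) h k/c)`; `BFI.dispA = ∑_{c,d,k} |innerAk|²`
(`BFI.dispA_natCast_eq`; the tree's `BFI.innerA` is the case `k = 1`). [cite: BombieriFriedlanderIwaniecActa1986, §8 (8.2)–(8.3) p. 226] -/
def innerAk (a : ℤ) (H : ℕ) (Q' : ℝ) (α : ℕ → ℕ → ℂ) (c d k : ℕ) : ℂ :=
  ∑ h ∈ Finset.Icc 1 H, ∑ q ∈ (Finset.Icc 1 ⌊Q'⌋₊).filter (fun q => c.Coprime (d * q)),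
    α h q * (𝐞 (((((a : ZMod c) * ((d * q : ℕ) : ZMod c)⁻¹).val : ℕ) : ℝ) * h * k / c) : ℂ)

/-- `𝒜(C,D,K,H,Q') = ∑_{c≤C} ∑_{d≤D} ∑_{k≤K} |innerAk(c,d,k)|²` for a natural number `H`. [folklore] -/
theorem dispA_natCast_eq (a : ℤ) (C D K : ℝ) (H : ℕ) (Q' : ℝ) (α : ℕ → ℕ → ℂ) :
    dispA a C D K (H : ℝ) Q' α = ∑ c ∈ Finset.Icc 1 ⌊C⌋₊, ∑ d ∈ Finset.Icc 1 ⌊D⌋₊,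
      ∑ k ∈ Finset.Icc 1 ⌊K⌋₊, ‖innerAk a H Q' α c d k‖ ^ 2 := by
  unfold dispA innerAk
  simp only [Nat.floor_natCast]

open Classical in
/-- **The kernel of `ℛ₁⁺(q₀)` is the inner sum of `𝒜`** (BFI (8.1)–(8.3), p. 226): for `Q ≥ 0`,
`1 ≤ q₀ ≤ Q₀`, `r, q₂ ≥ 1`, `n₁ ≥ 2`,
`K(ξ; r,q₂,n₁,n₂) = [Out] · innerAk(a·sign t; H, 2Q; α_ξ; c = n₁q₂', d = n₂, k = |t|)`.
[cite: BombieriFriedlanderIwaniecActa1986, §8 (8.1)–(8.3) p. 226] -/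
theorem Kker_eq {a : ℤ} {Q Q₀ : ℝ} (hQ : 0 ≤ Q) (γ : ℕ → ℝ) {q₀ : ℕ} (hq₀ : 0 < q₀)
    (hq₀Q : (q₀ : ℝ) ≤ Q₀) (H : ℕ) (ξ : ℝ) {r q₂ n₁ : ℕ} (hr : 0 < r) (hq₂ : 0 < q₂) (hn₁ : 1 < n₁)
    (n₂ : ℕ) :
    Kker a Q Q₀ γ q₀ H ξ r q₂ n₁ n₂ =
      if Out a q₀ r q₂ n₁ n₂ then
        innerAk (a * sOut q₀ r n₁ n₂) H (2 * Q) (alphaRaw a Q γ q₀ ξ) (n₁ * (q₂ / q₀)) n₂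
          (kOut q₀ r n₁ n₂)
      else 0 := by
  unfold Kker innerAk
  by_cases hO : Out a q₀ r q₂ n₁ n₂
  · rw [if_pos hO]
    refine Finset.sum_congr rfl fun h _ => ?_
    -- reindex `q₁ = q₀ q`
    set F : ℕ → ℂ := fun q₁ =>
      if Nat.gcd q₁ q₂ = q₀ ∧ (Main Q₀ q₁ q₂ n₁ n₂ ∧ Solvable a r q₁ q₂ n₁ n₂) then
        ((γ q₁ / q₁ : ℝ) : ℂ) * (𝐞 (-(ξ * h / q₁)) : ℂ) * (𝐞 (bfiPhase a r q₁ q₂ n₁ n₂ h) : ℂ)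
      else 0 with hF
    have step1 : ∑ q₁ ∈ dyadic Q, F q₁ = ∑ q₁ ∈ dyadic Q, (if q₀ ∣ q₁ then F q₁ else 0) := by
      refine Finset.sum_congr rfl fun q₁ _ => ?_
      by_cases hd : q₀ ∣ q₁
      · rw [if_pos hd]
      · rw [if_neg hd, hF]
        simp only
        rw [if_neg]
        rintro ⟨hg, _⟩
        exact hd (hg ▸ Nat.gcd_dvd_left q₁ q₂)
    rw [step1, sum_dyadic_dvd_eq_sum_mul hQ hq₀ F, Finset.sum_filter]
    refine Finset.sum_congr rfl fun q hq => ?_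
    have hq0 : 0 < q := (Finset.mem_Icc.1 hq).1
    have hiff := conds_mul_iff (a := a) (n₂ := n₂) hq₀ hq₀Q hr hq₂ hn₁ hq0
    simp only [hF]
    unfold alphaRaw
    by_cases hmem : q₀ * q ∈ dyadic Q
    · rw [if_pos hmem]
      by_cases hP : Nat.gcd (q₀ * q) q₂ = q₀ ∧
          (Main Q₀ (q₀ * q) q₂ n₁ n₂ ∧ Solvable a r (q₀ * q) q₂ n₁ n₂)
      · obtain ⟨_, hqa, hfil⟩ := hiff.1 hP
        rw [if_pos hP, if_pos hfil, if_pos ⟨hmem, hqa⟩,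
          e_bfiPhase_eq hq₀ hq₂ (by omega) hO hP.1 h]
      · rw [if_neg hP]
        by_cases hfil : (n₁ * (q₂ / q₀)).Coprime (n₂ * q)
        · rw [if_pos hfil, if_neg, zero_mul]
          rintro ⟨_, hqa⟩
          exact hP (hiff.2 ⟨hO, hqa, hfil⟩)
        · rw [if_neg hfil]
    · rw [if_neg hmem]
      by_cases hfil : (n₁ * (q₂ / q₀)).Coprime (n₂ * q)
      · rw [if_pos hfil, if_neg (fun h' => hmem h'.1), zero_mul]
      · rw [if_neg hfil]
  · rw [if_neg hO]
    refine Finset.sum_eq_zero fun h _ => Finset.sum_eq_zero fun q₁ hq₁mem => ?_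
    rw [if_neg]
    rintro ⟨hg, hMS⟩
    -- `q₁ = q₀ (q₁/q₀)` and the conditions force `Out`
    have hd : q₀ ∣ q₁ := hg ▸ Nat.gcd_dvd_left q₁ q₂
    have hq₁0 : 0 < q₁ := pos_of_mem_dyadic hQ hq₁mem
    have hq0 : 0 < q₁ / q₀ := Nat.div_pos (Nat.le_of_dvd hq₁0 hd) hq₀
    have e : q₁ = q₀ * (q₁ / q₀) := (Nat.mul_div_cancel' hd).symm
    rw [e] at hg hMS
    exact hO ((conds_mul_iff (a := a) (n₂ := n₂) hq₀ hq₀Q hr hq₂ hn₁ hq0).1 ⟨hg, hMS⟩).1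


/-! ### Counting the outer indices over a point of `𝒜` -/

/-- The data `(sign t, (c, (d, k)))` of an outer index `o = ((r, q₂), (n₁, n₂))`. [folklore] -/
def yOut (q₀ : ℕ) (o : (ℕ × ℕ) × (ℕ × ℕ)) : ℤ × (ℕ × (ℕ × ℕ)) :=
  (sOut q₀ o.1.1 o.2.1 o.2.2, (o.2.1 * (o.1.2 / q₀), (o.2.2, kOut q₀ o.1.1 o.2.1 o.2.2)))

/-- The box of `𝒜(4NQ, 2N, 2N/R, H, 2Q)` together with the sign. [folklore] -/
def boxA (N Q R : ℝ) : Finset (ℤ × (ℕ × (ℕ × ℕ))) :=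
  ({1, -1} : Finset ℤ) ×ˢ (Finset.Icc 1 ⌊4 * N * Q⌋₊ ×ˢ (Finset.Icc 1 ⌊2 * N⌋₊ ×ˢ
    Finset.Icc 1 ⌊2 * N / R⌋₊))

/-- The outer indices satisfying `Out` map into the box: `sign t = ±1`, `1 ≤ c = n₁q₂' ≤ 4NQ`,
`1 ≤ d = n₂ ≤ 2N`, `1 ≤ k = |n₁−n₂|/(q₀r) ≤ 2N/R` (`N, Q ≥ 0`, `R > 0`).
[cite: BombieriFriedlanderIwaniecActa1986, §8 (8.2) p. 226] -/
theorem yOut_mem_boxA {a : ℤ} {N Q R : ℝ} (hN : 0 ≤ N) (hQ : 0 ≤ Q) (hR : 0 < R) {q₀ : ℕ}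
    (hq₀ : 0 < q₀) {o : (ℕ × ℕ) × (ℕ × ℕ)}
    (ho : o ∈ (dyadic R ×ˢ dyadic Q) ×ˢ (dyadic N ×ˢ dyadic N))
    (hOut : Out a q₀ o.1.1 o.1.2 o.2.1 o.2.2) : yOut q₀ o ∈ boxA N Q R := by
  obtain ⟨⟨r, q₂⟩, ⟨n₁, n₂⟩⟩ := o
  simp only [Finset.mem_product] at ho
  obtain ⟨⟨hr, hq₂⟩, hn₁, hn₂⟩ := ho
  obtain ⟨ht, ht0, hts⟩ := tOut_facts hOut
  have hr' := (mem_dyadic hR.le).1 hr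
  have hq₂' := (mem_dyadic hQ).1 hq₂
  have hn₁' := (mem_dyadic hN).1 hn₁
  have hn₂' := (mem_dyadic hN).1 hn₂
  have hdvd : q₀ ∣ q₂ := hOut.1
  have hn₁0 : 0 < n₁ := pos_of_mem_dyadic hN hn₁
  have hq₂0 : 0 < q₂ := pos_of_mem_dyadic hQ hq₂
  have hq₂'0 : 0 < q₂ / q₀ := Nat.div_pos (Nat.le_of_dvd hq₂0 hdvd) hq₀
  simp only [yOut, boxA, Finset.mem_product, Finset.mem_insert, Finset.mem_singleton,
    Finset.mem_Icc]
  refine ⟨?_, ⟨Nat.mul_pos hn₁0 hq₂'0, ?_⟩, ⟨pos_of_mem_dyadic hN hn₂, Nat.le_floor hn₂'.2⟩, ?_, ?_⟩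
  · rcases lt_or_gt_of_ne ht0 with h | h
    · right; exact Int.sign_eq_neg_one_of_neg h
    · left; exact Int.sign_eq_one_of_pos h
  · refine Nat.le_floor ?_
    push_cast
    have h1 : ((q₂ / q₀ : ℕ) : ℝ) ≤ q₂ := by exact_mod_cast Nat.div_le_self q₂ q₀
    have h2 : (0 : ℝ) ≤ (q₂ / q₀ : ℕ) := by positivity
    nlinarith [hn₁'.2, hq₂'.2, hn₁'.1]
  · -- `k ≥ 1`
    unfold kOut
    rw [Nat.one_le_iff_ne_zero]
    exact Int.natAbs_ne_zero.2 ht0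
  · -- `k ≤ 2N/R`
    refine Nat.le_floor ?_
    rw [le_div_iff₀ hR]
    have hk : ((q₀ * r : ℕ) : ℝ) * (kOut q₀ r n₁ n₂ : ℝ) = |((n₁ : ℝ) - n₂)| := by
      have e : (((n₁ : ℤ) - n₂ : ℤ) : ℝ) = ((q₀ * r : ℕ) : ℝ) * (tOut q₀ r n₁ n₂ : ℝ) := by
        exact_mod_cast ht
      have : |((n₁ : ℝ) - n₂)| = ((q₀ * r : ℕ) : ℝ) * |(tOut q₀ r n₁ n₂ : ℝ)| := by
        rw [show ((n₁ : ℝ) - n₂) = (((n₁ : ℤ) - n₂ : ℤ) : ℝ) by push_cast; ring, e, abs_mul,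
          abs_of_nonneg (by positivity : (0 : ℝ) ≤ ((q₀ * r : ℕ) : ℝ))]
      rw [this]
      unfold kOut
      rw [Nat.cast_natAbs, Int.cast_abs]
    have habs : |((n₁ : ℝ) - n₂)| ≤ 2 * N := by
      rw [abs_le]; constructor <;> linarith [hn₁'.1, hn₁'.2, hn₂'.1, hn₂'.2]
    have hqr : (R : ℝ) ≤ ((q₀ * r : ℕ) : ℝ) := by
      push_cast
      have : (1 : ℝ) ≤ q₀ := by exact_mod_cast hq₀
      nlinarith [hr'.1]
    have hk0 : (0 : ℝ) ≤ (kOut q₀ r n₁ n₂ : ℝ) := by positivity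
    calc (kOut q₀ r n₁ n₂ : ℝ) * R ≤ (kOut q₀ r n₁ n₂ : ℝ) * ((q₀ * r : ℕ) : ℝ) :=
          mul_le_mul_of_nonneg_left hqr hk0
      _ = |((n₁ : ℝ) - n₂)| := by rw [mul_comm, hk]
      _ ≤ 2 * N := habs

/-- **At most `τ(c)` outer indices over a point of `𝒜`**: the outer indices `o` with `Out` and
`yOut o = (s, c, d, k)` are determined by their `n₁`, a divisor of `c`
(`q₂ = q₀ c/n₁`, `n₂ = d`, `r = |n₁ − n₂|/(q₀ k)`). [cite: BombieriFriedlanderIwaniecActa1986, §8 (8.2) p. 226] -/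
theorem card_fibre_yOut_le {a : ℤ} {q₀ : ℕ} (S : Finset ((ℕ × ℕ) × (ℕ × ℕ)))
    (hS : ∀ o ∈ S, Out a q₀ o.1.1 o.1.2 o.2.1 o.2.2 ∧ 0 < o.2.1) (b : ℤ × (ℕ × (ℕ × ℕ)))
    (hb : 0 < b.2.1) :
    #(S.filter (fun o => yOut q₀ o = b)) ≤ σ 0 b.2.1 := by
  rw [ArithmeticFunction.sigma_zero_apply]
  refine Finset.card_le_card_of_injOn (fun o => o.2.1) ?_ ?_
  · intro o ho
    rw [Finset.mem_coe, Finset.mem_filter] at ho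
    obtain ⟨_, hy⟩ := ho
    rw [Finset.mem_coe, Nat.mem_divisors]
    refine ⟨?_, hb.ne'⟩
    have : b.2.1 = o.2.1 * (o.1.2 / q₀) := by rw [← hy]; rfl
    exact ⟨_, this⟩
  · intro o ho o' ho' heq
    rw [Finset.mem_coe, Finset.mem_filter] at ho ho'
    obtain ⟨hoS, hy⟩ := ho
    obtain ⟨ho'S, hy'⟩ := ho'
    obtain ⟨hO, hn₁0⟩ := hS o hoS
    obtain ⟨hO', _⟩ := hS o' ho'S
    have hyy : yOut q₀ o = yOut q₀ o' := hy.trans hy'.symm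
    simp only [yOut, Prod.mk.injEq] at hyy
    obtain ⟨hs, hc, hd, hk⟩ := hyy
    simp only at heq
    -- `q₂`
    have hq : o.1.2 = o'.1.2 := by
      rw [heq] at hc
      have h1 := Nat.eq_of_mul_eq_mul_left (heq ▸ hn₁0) hc
      rw [← Nat.mul_div_cancel' hO.1, ← Nat.mul_div_cancel' hO'.1, h1]
    -- `r`
    obtain ⟨ht, ht0, hts⟩ := tOut_facts hO
    obtain ⟨ht', _, hts'⟩ := tOut_facts hO'
    have htt : tOut q₀ o.1.1 o.2.1 o.2.2 = tOut q₀ o'.1.1 o'.2.1 o'.2.2 := by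
      rw [hts, hts', hs, hk]
    have hr : o.1.1 = o'.1.1 := by
      rw [htt] at ht
      rw [heq, hd] at ht
      rw [ht] at ht'
      have hne : tOut q₀ o'.1.1 o'.2.1 o'.2.2 ≠ 0 := htt ▸ ht0
      have := mul_right_cancel₀ hne ht'
      have hq₀r : ((q₀ * o.1.1 : ℕ) : ℤ) = ((q₀ * o'.1.1 : ℕ) : ℤ) := this
      have h2 : q₀ * o.1.1 = q₀ * o'.1.1 := by exact_mod_cast hq₀r
      rcases Nat.eq_zero_or_pos q₀ with hq | hq
      · -- `q₀ = 0` is impossible: `q₀ ∣ q₂`… but we only need: then `t` has denominator `0`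
        exfalso
        apply ht0
        unfold tOut
        rw [hq, zero_mul, Nat.cast_zero, Int.ediv_zero]
      · exact Nat.eq_of_mul_eq_mul_left hq h2
    exact Prod.ext (Prod.ext hr hq) (Prod.ext heq hd)


/-! ### `∑_o ‖K(ξ; o)‖²` against `𝒜` -/

/-- `innerAk` is linear in the coefficients. [folklore] -/
theorem innerAk_const_mul (a : ℤ) (H : ℕ) (Q' : ℝ) (z : ℂ) (α : ℕ → ℕ → ℂ) (c d k : ℕ) :
    innerAk a H Q' (fun h q => z * α h q) c d k = z * innerAk a H Q' α c d k := by
  unfold innerAk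
  rw [Finset.mul_sum]
  refine Finset.sum_congr rfl fun h _ => ?_
  rw [Finset.mul_sum]
  refine Finset.sum_congr rfl fun q _ => ?_
  ring

/-- The normalised coefficients `(Q/T_γ) α_raw` have modulus `≤ 1` when `|γ_q| ≤ T_γ` on `q ∼ Q`
(`Q, T_γ > 0`). [cite: BombieriFriedlanderIwaniecActa1986, §8 (8.3) p. 226] -/
theorem norm_alphaRaw_le {a : ℤ} {Q : ℝ} (hQ : 0 < Q) {γ : ℕ → ℝ} {Tγ : ℝ} (hTγ : 0 < Tγ)
    (hγ : ∀ q ∈ dyadic Q, |γ q| ≤ Tγ) (q₀ : ℕ) (ξ : ℝ) (h q : ℕ) :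
    ‖((Q / Tγ : ℝ) : ℂ) * alphaRaw a Q γ q₀ ξ h q‖ ≤ 1 := by
  unfold alphaRaw
  split_ifs with hc
  · obtain ⟨hmem, _⟩ := hc
    have h1 := (mem_dyadic hQ.le).1 hmem
    have hq0 : (0 : ℝ) < (q₀ * q : ℕ) := lt_trans hQ h1.1
    rw [norm_mul, norm_mul, Circle.norm_coe, mul_one, Complex.norm_real, Complex.norm_real,
      Real.norm_eq_abs, Real.norm_eq_abs, abs_div, abs_div, abs_of_pos hQ, abs_of_pos hTγ,
      abs_of_pos hq0]
    rw [div_mul_div_comm, div_le_one (by positivity)]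
    calc Q * |γ (q₀ * q)| ≤ ((q₀ * q : ℕ) : ℝ) * Tγ :=
          mul_le_mul h1.1.le (hγ _ hmem) (abs_nonneg _) hq0.le
      _ = Tγ * ((q₀ * q : ℕ) : ℝ) := mul_comm _ _
  · rw [mul_zero, norm_zero]; exact zero_le_one

/-- **`∑_o ‖K(ξ;o)‖² ≤ (T_γ/Q)² T_τ (E₊ + E₋)`**: the kernels are `(T_γ/Q)` times inner sums of
`𝒜(±a; 4NQ, 2N, 2N/R, H, 2Q)` with coefficients of modulus `≤ 1`, each point of `𝒜` being hit by at
most `τ(c) ≤ T_τ` outer indices (BFI (8.2): "Hence, by Cauchy's inequality and by (A₃) we get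
`ℛ₁ ≪ x^ε M Q^{−3/2} R⁻¹ ‖β‖² sup 𝒜^{1/2}(4NQ, 2N, K, H, 2Q)`").
[cite: BombieriFriedlanderIwaniecActa1986, §8 (8.2) p. 226] -/
theorem sum_norm_sq_Kker_le {a : ℤ} {N Q R Q₀ : ℝ} (hN : 1 ≤ N) (hQ : 0 < Q) (hR : 0 < R)
    {γ : ℕ → ℝ} {Tγ : ℝ} (hTγ : 0 < Tγ) (hγ : ∀ q ∈ dyadic Q, |γ q| ≤ Tγ)
    {Tτ : ℝ} (hτ0 : 0 ≤ Tτ) (hτ : ∀ c ∈ Finset.Icc 1 ⌊4 * N * Q⌋₊, (σ 0 c : ℝ) ≤ Tτ)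
    {q₀ : ℕ} (hq₀ : 0 < q₀) (hq₀Q : (q₀ : ℝ) ≤ Q₀) (H : ℕ) {E : ℝ}
    (hE : ∀ s ∈ ({1, -1} : Finset ℤ), ∀ α : ℕ → ℕ → ℂ, (∀ h q, ‖α h q‖ ≤ 1) →
      dispA (a * s) (4 * N * Q) (2 * N) (2 * N / R) (H : ℝ) (2 * Q) α ≤ E) (ξ : ℝ) :
    ∑ o ∈ (dyadic R ×ˢ dyadic Q) ×ˢ (dyadic N ×ˢ dyadic N),
        ‖Kker a Q Q₀ γ q₀ H ξ o.1.1 o.1.2 o.2.1 o.2.2‖ ^ 2 ≤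
      (Tγ / Q) ^ 2 * (Tτ * (E + E)) := by
  classical
  have hN0 : 0 ≤ N := by linarith
  set P := (dyadic R ×ˢ dyadic Q) ×ˢ (dyadic N ×ˢ dyadic N) with hP
  set αN : ℕ → ℕ → ℂ := fun h q => ((Q / Tγ : ℝ) : ℂ) * alphaRaw a Q γ q₀ ξ h q with hαN
  have hαN1 : ∀ h q, ‖αN h q‖ ≤ 1 := fun h q => norm_alphaRaw_le hQ hTγ hγ q₀ ξ h q
  have hraw : alphaRaw a Q γ q₀ ξ = fun h q => ((Tγ / Q : ℝ) : ℂ) * αN h q := by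
    funext h q
    simp only [hαN]
    rw [← mul_assoc, ← Complex.ofReal_mul, show Tγ / Q * (Q / Tγ) = 1 by field_simp,
      Complex.ofReal_one, one_mul]
  set g : ℤ × (ℕ × (ℕ × ℕ)) → ℝ := fun b => ‖innerAk (a * b.1) H (2 * Q) αN b.2.1 b.2.2.1 b.2.2.2‖ ^ 2
    with hg
  -- pointwise: `‖K(o)‖² = [Out] (Tγ/Q)² g(yOut o)`
  have hpt : ∀ o ∈ P, ‖Kker a Q Q₀ γ q₀ H ξ o.1.1 o.1.2 o.2.1 o.2.2‖ ^ 2 =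
      if Out a q₀ o.1.1 o.1.2 o.2.1 o.2.2 then (Tγ / Q) ^ 2 * g (yOut q₀ o) else 0 := by
    intro o ho
    simp only [hP, Finset.mem_product] at ho
    obtain ⟨⟨hr, hq₂⟩, hn₁, hn₂⟩ := ho
    have hn₁2 : 1 < o.2.1 := by
      have := ((mem_dyadic hN0).1 hn₁).1
      have : (1 : ℝ) < o.2.1 := lt_of_le_of_lt hN this
      exact_mod_cast this
    rw [Kker_eq hQ.le γ hq₀ hq₀Q H ξ (pos_of_mem_dyadic hR.le hr) (pos_of_mem_dyadic hQ.le hq₂) hn₁2]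
    split_ifs with hO
    · rw [hraw, innerAk_const_mul, norm_mul, mul_pow, Complex.norm_real, Real.norm_eq_abs,
        abs_of_pos (div_pos hTγ hQ)]
      rfl
    · rw [norm_zero, zero_pow two_ne_zero]
  rw [Finset.sum_congr rfl hpt, ← Finset.sum_filter, ← Finset.mul_sum]
  refine mul_le_mul_of_nonneg_left ?_ (sq_nonneg _)
  -- fibrewise over the box
  set S := P.filter (fun o => Out a q₀ o.1.1 o.1.2 o.2.1 o.2.2) with hS
  have hmaps : ∀ o ∈ S, yOut q₀ o ∈ boxA N Q R := by
    intro o ho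
    rw [hS, Finset.mem_filter] at ho
    exact yOut_mem_boxA hN0 hQ.le hR hq₀ ho.1 ho.2
  have hSpos : ∀ o ∈ S, Out a q₀ o.1.1 o.1.2 o.2.1 o.2.2 ∧ 0 < o.2.1 := by
    intro o ho
    simp only [hS, Finset.mem_filter, hP, Finset.mem_product] at ho
    exact ⟨ho.2, pos_of_mem_dyadic hN0 ho.1.2.1⟩
  rw [← Finset.sum_fiberwise_of_maps_to hmaps]
  have hg0 : ∀ b, 0 ≤ g b := fun b => sq_nonneg _
  calc ∑ b ∈ boxA N Q R, ∑ o ∈ S.filter (fun o => yOut q₀ o = b), g (yOut q₀ o)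
      = ∑ b ∈ boxA N Q R, (#(S.filter (fun o => yOut q₀ o = b)) : ℝ) * g b := by
        refine Finset.sum_congr rfl fun b _ => ?_
        rw [Finset.sum_congr rfl (fun o ho => by rw [(Finset.mem_filter.1 ho).2]), Finset.sum_const,
          nsmul_eq_mul]
    _ ≤ ∑ b ∈ boxA N Q R, Tτ * g b := by
        refine Finset.sum_le_sum fun b hb => mul_le_mul_of_nonneg_right ?_ (hg0 b)
        simp only [boxA, Finset.mem_product] at hb
        have hc := hb.2.1
        have hc1 : 0 < b.2.1 := (Finset.mem_Icc.1 hc).1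
        exact le_trans (by exact_mod_cast card_fibre_yOut_le S hSpos b hc1) (hτ _ hc)
    _ = Tτ * ∑ b ∈ boxA N Q R, g b := (Finset.mul_sum _ _ _).symm
    _ ≤ Tτ * (E + E) := by
        refine mul_le_mul_of_nonneg_left ?_ hτ0
        rw [boxA, Finset.sum_product, Finset.sum_pair (by norm_num)]
        refine add_le_add ?_ ?_
        · have h1 := hE 1 (by simp) αN hαN1
          rw [dispA_natCast_eq] at h1
          simp only [Finset.sum_product] at h1 ⊢
          exact h1
        · have h1 := hE (-1) (by simp) αN hαN1
          rw [dispA_natCast_eq] at h1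
          simp only [Finset.sum_product] at h1 ⊢
          exact h1

/-- **`∑_{o, Out} (γ_{q₂}β_{n₁}β_{n₂})² ≤ T_γ² (2Q+1) T_τ ‖β‖⁴`**: for fixed `n₁ ≠ n₂` the admissible
`r` divide `|n₁ − n₂|`. [cite: BombieriFriedlanderIwaniecActa1986, §8 (8.2) p. 226] -/
theorem sum_sq_weights_le {a : ℤ} {N Q R : ℝ} (hN : 0 ≤ N) (hQ : 1 / 2 ≤ Q)
    {γ : ℕ → ℝ} {Tγ : ℝ} (hγ : ∀ q ∈ dyadic Q, |γ q| ≤ Tγ)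
    {Tτ : ℝ} (hτ0 : 0 ≤ Tτ) (hτ : ∀ c ∈ Finset.Icc 1 ⌊4 * N * Q⌋₊, (σ 0 c : ℝ) ≤ Tτ) (q₀ : ℕ)
    (β : ℕ → ℝ) :
    ∑ o ∈ (dyadic R ×ˢ dyadic Q) ×ˢ (dyadic N ×ˢ dyadic N),
        (if Out a q₀ o.1.1 o.1.2 o.2.1 o.2.2 then (γ o.1.2 * β o.2.1 * β o.2.2) ^ 2 else 0) ≤
      Tγ ^ 2 * (2 * Q + 1) * Tτ * l2Sq N β ^ 2 := by
  classical
  have hQ0 : 0 ≤ Q := by linarith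
  -- the `r`-count for fixed `(q₂, n₁, n₂)`
  have hinner : ∀ q₂ ∈ dyadic Q, ∀ n₁ ∈ dyadic N, ∀ n₂ ∈ dyadic N,
      ∑ r ∈ dyadic R, (if Out a q₀ r q₂ n₁ n₂ then (γ q₂ * β n₁ * β n₂) ^ 2 else 0) ≤
        Tγ ^ 2 * Tτ * (β n₁ ^ 2 * β n₂ ^ 2) := by
    intro q₂ hq₂ n₁ hn₁ n₂ hn₂
    have hn₁' := (mem_dyadic hN).1 hn₁
    have hn₂' := (mem_dyadic hN).1 hn₂
    have hg2 : (γ q₂ * β n₁ * β n₂) ^ 2 ≤ Tγ ^ 2 * (β n₁ ^ 2 * β n₂ ^ 2) := by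
      have h1 : γ q₂ ^ 2 ≤ Tγ ^ 2 := by
        rw [← sq_abs (γ q₂)]
        exact pow_le_pow_left₀ (abs_nonneg _) (hγ q₂ hq₂) 2
      rw [show (γ q₂ * β n₁ * β n₂) ^ 2 = γ q₂ ^ 2 * (β n₁ ^ 2 * β n₂ ^ 2) by ring]
      exact mul_le_mul_of_nonneg_right h1 (by positivity)
    rw [← Finset.sum_filter, Finset.sum_const, nsmul_eq_mul]
    -- the number of admissible `r` is `≤ Tτ`
    have hcard : (#((dyadic R).filter (fun r => Out a q₀ r q₂ n₁ n₂)) : ℝ) ≤ Tτ := by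
      by_cases hne : n₁ = n₂
      · rw [Finset.filter_false_of_mem, Finset.card_empty, Nat.cast_zero]
        · exact hτ0
        · intro r _ hO; exact hO.2.2.1 hne
      · set m : ℕ := Int.natAbs ((n₁ : ℤ) - n₂) with hm
        have hm1 : 1 ≤ m := by
          rw [Nat.one_le_iff_ne_zero, hm, Ne, Int.natAbs_eq_zero, sub_eq_zero]
          exact fun h => hne (by exact_mod_cast h)
        have hmR : (m : ℝ) = |(n₁ : ℝ) - n₂| := by
          rw [hm, Nat.cast_natAbs]
          push_cast
          rfl
        have hm2 : m ≤ ⌊4 * N * Q⌋₊ := by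
          refine Nat.le_floor ?_
          rw [hmR, abs_le]
          constructor <;> nlinarith [hn₁'.1, hn₁'.2, hn₂'.1, hn₂'.2]
        have hsub : (dyadic R).filter (fun r => Out a q₀ r q₂ n₁ n₂) ⊆ m.divisors := by
          intro r hr
          rw [Finset.mem_filter] at hr
          obtain ⟨_, hO⟩ := hr
          obtain ⟨ht, _, _⟩ := tOut_facts hO
          rw [Nat.mem_divisors]
          refine ⟨?_, by omega⟩
          have h1 : (r : ℤ) ∣ ((n₁ : ℤ) - n₂) :=
            ⟨(q₀ : ℤ) * tOut q₀ r n₁ n₂, by rw [ht]; push_cast; ring⟩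
          have h2 := Int.natAbs_dvd_natAbs.2 h1
          rwa [Int.natAbs_natCast] at h2
        calc (#((dyadic R).filter (fun r => Out a q₀ r q₂ n₁ n₂)) : ℝ) ≤ (#(m.divisors) : ℝ) := by
              exact_mod_cast Finset.card_le_card hsub
          _ = (σ 0 m : ℝ) := by rw [ArithmeticFunction.sigma_zero_apply]
          _ ≤ Tτ := hτ m (Finset.mem_Icc.2 ⟨hm1, hm2⟩)
    calc (#((dyadic R).filter (fun r => Out a q₀ r q₂ n₁ n₂)) : ℝ) * (γ q₂ * β n₁ * β n₂) ^ 2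
        ≤ Tτ * (Tγ ^ 2 * (β n₁ ^ 2 * β n₂ ^ 2)) :=
          mul_le_mul hcard hg2 (sq_nonneg _) hτ0
      _ = _ := by ring
  -- sum over `(q₂, n₁, n₂)`
  simp only [Finset.sum_product]
  rw [Finset.sum_comm]
  have hq₂sum : ∀ q₂ ∈ dyadic Q,
      ∑ r ∈ dyadic R, ∑ n₁ ∈ dyadic N, ∑ n₂ ∈ dyadic N,
          (if Out a q₀ r q₂ n₁ n₂ then (γ q₂ * β n₁ * β n₂) ^ 2 else 0) ≤
        Tγ ^ 2 * Tτ * l2Sq N β ^ 2 := by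
    intro q₂ hq₂
    rw [Finset.sum_comm]
    calc ∑ n₁ ∈ dyadic N, ∑ r ∈ dyadic R, ∑ n₂ ∈ dyadic N,
          (if Out a q₀ r q₂ n₁ n₂ then (γ q₂ * β n₁ * β n₂) ^ 2 else 0)
        = ∑ n₁ ∈ dyadic N, ∑ n₂ ∈ dyadic N, ∑ r ∈ dyadic R,
          (if Out a q₀ r q₂ n₁ n₂ then (γ q₂ * β n₁ * β n₂) ^ 2 else 0) :=
          Finset.sum_congr rfl fun n₁ _ => Finset.sum_comm
      _ ≤ ∑ n₁ ∈ dyadic N, ∑ n₂ ∈ dyadic N, Tγ ^ 2 * Tτ * (β n₁ ^ 2 * β n₂ ^ 2) :=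
          Finset.sum_le_sum fun n₁ hn₁ => Finset.sum_le_sum fun n₂ hn₂ => hinner q₂ hq₂ n₁ hn₁ n₂ hn₂
      _ = Tγ ^ 2 * Tτ * l2Sq N β ^ 2 := by
          rw [l2Sq, sq (∑ n ∈ dyadic N, β n ^ 2), Finset.sum_mul_sum, Finset.mul_sum]
          refine Finset.sum_congr rfl fun n₁ _ => ?_
          rw [Finset.mul_sum]
  calc ∑ q₂ ∈ dyadic Q, ∑ r ∈ dyadic R, ∑ n₁ ∈ dyadic N, ∑ n₂ ∈ dyadic N,
          (if Out a q₀ r q₂ n₁ n₂ then (γ q₂ * β n₁ * β n₂) ^ 2 else 0)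
      ≤ ∑ q₂ ∈ dyadic Q, Tγ ^ 2 * Tτ * l2Sq N β ^ 2 := Finset.sum_le_sum hq₂sum
    _ = #(dyadic Q) * (Tγ ^ 2 * Tτ * l2Sq N β ^ 2) := by rw [Finset.sum_const, nsmul_eq_mul]
    _ ≤ (2 * Q + 1) * (Tγ ^ 2 * Tτ * l2Sq N β ^ 2) :=
        mul_le_mul_of_nonneg_right (card_dyadic_le hQ0) (by positivity)
    _ = _ := by ring


/-! ### The bound for `ℛ₁⁺(q₀)` and for `ℛ₁` -/

/-- Off the support: for an outer index with `Out`, `q₂ ∼ Q`, `r ∼ R` (`Q, R > 0`, `0 < Y ≤ M`),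
`f(e ξ) = 0` unless `ξ ∈ [0, (2M+Y) q₀/(QR)]` (`e = (q₂/q₀) r > QR/q₀`). [folklore] -/
theorem bumpC_outer_eq_zero {a : ℤ} {M Y Q R : ℝ} (hY : 0 < Y) (hYM : Y ≤ M) (hQ : 0 < Q)
    (hR : 0 < R) {q₀ r q₂ n₁ n₂ : ℕ} (hq₀ : 0 < q₀) (hO : Out a q₀ r q₂ n₁ n₂)
    (hq₂ : q₂ ∈ dyadic Q) (hr : r ∈ dyadic R) {ξ : ℝ}
    (hξ : ξ ∉ Set.Icc (0 : ℝ) ((2 * M + Y) * q₀ / (Q * R))) :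
    bumpC M Y ((q₂ / q₀ * r : ℕ) * ξ) = 0 := by
  have hM : 0 ≤ M := hY.le.trans hYM
  have hdvd : q₀ ∣ q₂ := hO.1
  have hq₂' := (mem_dyadic hQ.le).1 hq₂
  have hr' := (mem_dyadic hR.le).1 hr
  have he : ((q₂ / q₀ * r : ℕ) : ℝ) = (q₂ : ℝ) / q₀ * r := by
    push_cast
    rw [Nat.cast_div hdvd (by exact_mod_cast hq₀.ne')]
  have hepos : (0 : ℝ) < (q₂ : ℝ) / q₀ * r := by
    have : (0 : ℝ) < q₂ := lt_trans hQ hq₂'.1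
    have : (0 : ℝ) < r := lt_trans hR hr'.1
    positivity
  rw [Set.mem_Icc, not_and_or, not_le, not_le] at hξ
  refine bumpC_eq_zero hY hM ?_
  rw [he]
  rcases hξ with hξ | hξ
  · left
    have : (q₂ : ℝ) / q₀ * r * ξ < 0 := mul_neg_of_pos_of_neg hepos hξ
    linarith
  · right
    have hq₀' : (0 : ℝ) < q₀ := by exact_mod_cast hq₀
    have h1 : Q * R / q₀ ≤ (q₂ : ℝ) / q₀ * r := by
      rw [div_le_iff₀ hq₀', show (q₂ : ℝ) / q₀ * r * q₀ = q₂ * r by field_simp]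
      exact mul_le_mul hq₂'.1.le hr'.1.le hR.le (by positivity)
    have hΞ : (0 : ℝ) ≤ (2 * M + Y) * q₀ / (Q * R) := by positivity
    calc 2 * M + Y = (Q * R / q₀) * ((2 * M + Y) * q₀ / (Q * R)) := by field_simp
      _ ≤ ((q₂ : ℝ) / q₀ * r) * ((2 * M + Y) * q₀ / (Q * R)) :=
          mul_le_mul_of_nonneg_right h1 hΞ
      _ ≤ ((q₂ : ℝ) / q₀ * r) * ξ := mul_le_mul_of_nonneg_left hξ.le hepos.le

open Classical in
/-- `ξ ↦ K(ξ; o)` is continuous. [folklore] -/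
theorem continuous_Kker (a : ℤ) (Q Q₀ : ℝ) (γ : ℕ → ℝ) (q₀ H : ℕ) (r q₂ n₁ n₂ : ℕ) :
    Continuous fun ξ => Kker a Q Q₀ γ q₀ H ξ r q₂ n₁ n₂ := by
  unfold Kker
  refine continuous_finsetSum _ fun h _ => continuous_finsetSum _ fun q₁ _ => ?_
  exact continuous_Kker_term a Q₀ γ q₀ r q₂ n₁ n₂ h q₁

/-- **The bound for `ℛ₁⁺(q₀)`** (BFI (8.2), p. 226, one `q₀`, all constants explicit): for
`0 < Y ≤ M`, `N ≥ 1`, `Q, R ≥ 1/2`, `1 ≤ q₀ ≤ Q₀`, `|γ_q| ≤ T_γ` on `q ∼ Q`, `τ ≤ T_τ` on `[1, 4NQ]`,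
and `𝒜(±a; 4NQ, 2N, 2N/R, H, 2Q; α) ≤ E` for all `|α| ≤ 1`,
`‖ℛ₁⁺(q₀)‖ ≤ ((2M+Y) q₀/(QR)) · √(T_γ²(2Q+1)T_τ‖β‖⁴) · √((T_γ/Q)² T_τ (E+E))`.
[cite: BombieriFriedlanderIwaniecActa1986, §8 (8.2) p. 226] -/
theorem norm_calR1q_le {a : ℤ} {M Y N Q R Q₀ : ℝ} (hY : 0 < Y) (hYM : Y ≤ M) (hN : 1 ≤ N)
    (hQ : 1 / 2 ≤ Q) (hR : 1 / 2 ≤ R) {γ : ℕ → ℝ} {Tγ : ℝ} (hTγ : 0 < Tγ)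
    (hγ : ∀ q ∈ dyadic Q, |γ q| ≤ Tγ) {Tτ : ℝ} (hτ0 : 0 ≤ Tτ)
    (hτ : ∀ c ∈ Finset.Icc 1 ⌊4 * N * Q⌋₊, (σ 0 c : ℝ) ≤ Tτ) {q₀ : ℕ} (hq₀ : 0 < q₀)
    (hq₀Q : (q₀ : ℝ) ≤ Q₀) (β : ℕ → ℝ) (H : ℕ) {E : ℝ}
    (hE : ∀ s ∈ ({1, -1} : Finset ℤ), ∀ α : ℕ → ℕ → ℂ, (∀ h q, ‖α h q‖ ≤ 1) →
      dispA (a * s) (4 * N * Q) (2 * N) (2 * N / R) (H : ℝ) (2 * Q) α ≤ E) :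
    ‖calR1q a M Y N Q R Q₀ β γ H q₀‖ ≤
      ((2 * M + Y) * q₀ / (Q * R)) * (Real.sqrt (Tγ ^ 2 * (2 * Q + 1) * Tτ * l2Sq N β ^ 2) *
        Real.sqrt ((Tγ / Q) ^ 2 * (Tτ * (E + E)))) := by
  classical
  have hM : 0 ≤ M := hY.le.trans hYM
  have hN0 : 0 ≤ N := by linarith
  have hQ0 : 0 < Q := by linarith
  have hR0 : 0 < R := by linarith
  set P := (dyadic R ×ˢ dyadic Q) ×ˢ (dyadic N ×ˢ dyadic N) with hP
  set I : Set ℝ := Set.Icc (0 : ℝ) ((2 * M + Y) * q₀ / (Q * R)) with hI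
  set Cst : ℝ := Real.sqrt (Tγ ^ 2 * (2 * Q + 1) * Tτ * l2Sq N β ^ 2) *
    Real.sqrt ((Tγ / Q) ^ 2 * (Tτ * (E + E))) with hCst
  have hCst0 : 0 ≤ Cst := by positivity
  set Kf : ℝ → ((ℕ × ℕ) × (ℕ × ℕ)) → ℂ := fun ξ o => Kker a Q Q₀ γ q₀ H ξ o.1.1 o.1.2 o.2.1 o.2.2
    with hKf
  set w : ((ℕ × ℕ) × (ℕ × ℕ)) → ℝ := fun o => |γ o.1.2 * β o.2.1 * β o.2.2| with hw
  set F : ℝ → ℝ := fun ξ => ∑ o ∈ P, w o * ‖Kf ξ o‖ with hF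
  -- `K` vanishes off `Out`
  have hKzero : ∀ o ∈ P, ¬Out a q₀ o.1.1 o.1.2 o.2.1 o.2.2 → ∀ ξ, Kf ξ o = 0 := by
    intro o ho hO ξ
    simp only [hP, Finset.mem_product] at ho
    obtain ⟨⟨hr, hq₂⟩, hn₁, _⟩ := ho
    have hn₁2 : 1 < o.2.1 := by
      have := ((mem_dyadic hN0).1 hn₁).1
      have : (1 : ℝ) < o.2.1 := lt_of_le_of_lt hN this
      exact_mod_cast this
    simp only [hKf]
    rw [Kker_eq hQ0.le γ hq₀ hq₀Q H ξ (pos_of_mem_dyadic hR0.le hr) (pos_of_mem_dyadic hQ0.le hq₂)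
      hn₁2, if_neg hO]
  -- Step 1: pointwise Cauchy–Schwarz `F ξ ≤ Cst`
  have hFle : ∀ ξ, F ξ ≤ Cst := by
    intro ξ
    have hCS := Finset.sum_mul_sq_le_sq_mul_sq P
      (fun o => if Out a q₀ o.1.1 o.1.2 o.2.1 o.2.2 then w o else 0) (fun o => ‖Kf ξ o‖)
    have e1 : ∑ o ∈ P, (if Out a q₀ o.1.1 o.1.2 o.2.1 o.2.2 then w o else 0) * ‖Kf ξ o‖ = F ξ := by
      simp only [hF]
      refine Finset.sum_congr rfl fun o ho => ?_
      split_ifs with hO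
      · rfl
      · rw [hKzero o ho hO ξ, norm_zero, mul_zero, mul_zero]
    have e2 : ∑ o ∈ P, (if Out a q₀ o.1.1 o.1.2 o.2.1 o.2.2 then w o else 0) ^ 2 ≤
        Tγ ^ 2 * (2 * Q + 1) * Tτ * l2Sq N β ^ 2 := by
      refine le_trans (le_of_eq (Finset.sum_congr rfl fun o _ => ?_))
        (sum_sq_weights_le (a := a) (R := R) hN0 hQ hγ hτ0 hτ q₀ β)
      split_ifs
      · simp only [hw, sq_abs]
      · simp
    have e3 : ∑ o ∈ P, ‖Kf ξ o‖ ^ 2 ≤ (Tγ / Q) ^ 2 * (Tτ * (E + E)) :=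
      sum_norm_sq_Kker_le hN hQ0 hR0 hTγ hγ hτ0 hτ hq₀ hq₀Q H hE ξ
    rw [e1] at hCS
    have hF0 : 0 ≤ F ξ := Finset.sum_nonneg fun o _ => by positivity
    have hW0 : 0 ≤ ∑ o ∈ P, (if Out a q₀ o.1.1 o.1.2 o.2.1 o.2.2 then w o else 0) ^ 2 :=
      Finset.sum_nonneg fun o _ => sq_nonneg _
    have h4 : F ξ ^ 2 ≤ (Tγ ^ 2 * (2 * Q + 1) * Tτ * l2Sq N β ^ 2) * ((Tγ / Q) ^ 2 * (Tτ * (E + E))) :=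
      hCS.trans (mul_le_mul e2 e3 (Finset.sum_nonneg fun o _ => sq_nonneg _)
        (le_trans hW0 e2))
    calc F ξ = Real.sqrt (F ξ ^ 2) := (Real.sqrt_sq hF0).symm
      _ ≤ Real.sqrt ((Tγ ^ 2 * (2 * Q + 1) * Tτ * l2Sq N β ^ 2) * ((Tγ / Q) ^ 2 * (Tτ * (E + E)))) :=
          Real.sqrt_le_sqrt h4
      _ = Cst := by rw [hCst, Real.sqrt_mul (le_trans hW0 e2)]
  -- Step 2: each integral is bounded by `∫_I ‖K‖`
  have hrow : ∀ o ∈ P, ‖∫ ξ : ℝ, bumpC M Y ((o.1.2 / q₀ * o.1.1 : ℕ) * ξ) * Kf ξ o‖ ≤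
      ∫ ξ in I, ‖Kf ξ o‖ := by
    intro o ho
    have hKc : Continuous fun ξ => Kf ξ o := continuous_Kker a Q Q₀ γ q₀ H _ _ _ _
    by_cases hO : Out a q₀ o.1.1 o.1.2 o.2.1 o.2.2
    · have ho' := ho
      simp only [hP, Finset.mem_product] at ho'
      obtain ⟨⟨hr, hq₂⟩, _, _⟩ := ho'
      have he : 0 < o.1.2 / q₀ * o.1.1 :=
        Nat.mul_pos (Nat.div_pos (Nat.le_of_dvd (pos_of_mem_dyadic hQ0.le hq₂) hO.1) hq₀)
          (pos_of_mem_dyadic hR0.le hr)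
      obtain ⟨hcont, hsupp⟩ := continuous_hasCompactSupport_bumpC_comp hY hM he
      have hint : Integrable (fun ξ : ℝ => bumpC M Y ((o.1.2 / q₀ * o.1.1 : ℕ) * ξ) * Kf ξ o) :=
        (hcont.mul hKc).integrable_of_hasCompactSupport hsupp.mul_right
      refine (norm_integral_le_integral_norm _).trans ?_
      rw [← integral_indicator measurableSet_Icc]
      refine integral_mono hint.norm ?_ fun ξ => ?_
      · rw [integrable_indicator_iff measurableSet_Icc]
        exact (hKc.norm.continuousOn).integrableOn_Icc
      · by_cases hξ : ξ ∈ I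
        · rw [Set.indicator_of_mem hξ, norm_mul]
          exact mul_le_of_le_one_left (norm_nonneg _) (norm_bumpC_le_one hY hM _)
        · rw [Set.indicator_of_notMem hξ, bumpC_outer_eq_zero hY hYM hQ0 hR0 hq₀ hO hq₂ hr hξ,
            zero_mul, norm_zero]
    · have h0 : (fun ξ : ℝ => bumpC M Y ((o.1.2 / q₀ * o.1.1 : ℕ) * ξ) * Kf ξ o) = fun _ => 0 := by
        funext ξ; rw [hKzero o ho hO ξ, mul_zero]
      rw [h0, integral_zero, norm_zero]
      exact integral_nonneg fun ξ => norm_nonneg _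
  -- Step 3: assemble
  have hvol : volume I < ⊤ := by rw [hI, Real.volume_Icc]; exact ENNReal.ofReal_lt_top
  have hIreal : volume.real I = (2 * M + Y) * q₀ / (Q * R) := by
    rw [Measure.real, hI, Real.volume_Icc, sub_zero, ENNReal.toReal_ofReal (by positivity)]
  calc ‖calR1q a M Y N Q R Q₀ β γ H q₀‖
      = ‖∑ o ∈ P, ((γ o.1.2 * β o.2.1 * β o.2.2 : ℝ) : ℂ) *
          ∫ ξ : ℝ, bumpC M Y ((o.1.2 / q₀ * o.1.1 : ℕ) * ξ) * Kf ξ o‖ := by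
        rw [calR1q_eq_integral hY hYM N hQ0.le hR0.le Q₀ β γ H hq₀]
        simp only [hP, Finset.sum_product, hKf]
    _ ≤ ∑ o ∈ P, w o * ∫ ξ in I, ‖Kf ξ o‖ := by
        refine (norm_sum_le _ _).trans (Finset.sum_le_sum fun o ho => ?_)
        rw [norm_mul, Complex.norm_real, Real.norm_eq_abs]
        exact mul_le_mul_of_nonneg_left (hrow o ho) (abs_nonneg _)
    _ = ∫ ξ in I, F ξ := by
        rw [hF, integral_finsetSum _ fun o _ => ?_]
        · refine Finset.sum_congr rfl fun o _ => ?_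
          rw [integral_const_mul]
        · exact ((continuous_Kker a Q Q₀ γ q₀ H _ _ _ _).norm.continuousOn.integrableOn_Icc).const_mul _
    _ ≤ Cst * volume.real I := by
        have hb := norm_setIntegral_le_of_norm_le_const hvol (f := F) (C := Cst)
          (fun ξ _ => by
            rw [Real.norm_of_nonneg (Finset.sum_nonneg fun o _ => by positivity)]
            exact hFle ξ)
        exact le_trans (Real.le_norm_self _) hb
    _ = _ := by rw [hIreal]; ring


/-- **The bound (8.2) for `ℛ₁`** (BFI p. 226: "`ℛ₁ ≪ x^ε M Q^{−3/2} R⁻¹ ‖β‖² sup 𝒜^{1/2}(4NQ, 2N, K, H, 2Q)`",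
here with the truncation `q₀ ≤ Q₀` explicit and every constant explicit): under the hypotheses of
`BFI.norm_calR1q_le` for all `1 ≤ q₀ ≤ Q₀` (`Q₀ ≥ 0`),
`‖ℛ₁‖ ≤ 2 · (2M+Y) Q₀²/(QR) · √(T_γ²(2Q+1)T_τ‖β‖⁴) · √((T_γ/Q)² T_τ (E+E))`
— of the shape `x^{o(1)} · M Q^{−3/2} R⁻¹ ‖β‖² E^{1/2}` once `Y ≍ M`, `T_γ, T_τ, Q₀ ≤ x^{o(1)}`.
[cite: BombieriFriedlanderIwaniecActa1986, §8 (8.2) p. 226] -/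
theorem norm_calR1_le {a : ℤ} {M Y N Q R Q₀ : ℝ} (hY : 0 < Y) (hYM : Y ≤ M) (hN : 1 ≤ N)
    (hQ : 1 / 2 ≤ Q) (hR : 1 / 2 ≤ R) (hQ₀ : 0 ≤ Q₀) {γ : ℕ → ℝ} {Tγ : ℝ} (hTγ : 0 < Tγ)
    (hγ : ∀ q ∈ dyadic Q, |γ q| ≤ Tγ) {Tτ : ℝ} (hτ0 : 0 ≤ Tτ)
    (hτ : ∀ c ∈ Finset.Icc 1 ⌊4 * N * Q⌋₊, (σ 0 c : ℝ) ≤ Tτ) (β : ℕ → ℝ) (H : ℕ) {E : ℝ}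
    (hE : ∀ s ∈ ({1, -1} : Finset ℤ), ∀ α : ℕ → ℕ → ℂ, (∀ h q, ‖α h q‖ ≤ 1) →
      dispA (a * s) (4 * N * Q) (2 * N) (2 * N / R) (H : ℝ) (2 * Q) α ≤ E) :
    ‖calR1 a M Y N Q R Q₀ β γ H‖ ≤
      2 * ((2 * M + Y) * Q₀ ^ 2 / (Q * R)) * (Real.sqrt (Tγ ^ 2 * (2 * Q + 1) * Tτ * l2Sq N β ^ 2) *
        Real.sqrt ((Tγ / Q) ^ 2 * (Tτ * (E + E)))) := by
  have hM : 0 ≤ M := hY.le.trans hYM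
  have hQ0 : 0 < Q := by linarith
  have hR0 : 0 < R := by linarith
  set Cst : ℝ := Real.sqrt (Tγ ^ 2 * (2 * Q + 1) * Tτ * l2Sq N β ^ 2) *
    Real.sqrt ((Tγ / Q) ^ 2 * (Tτ * (E + E))) with hCst
  have hCst0 : 0 ≤ Cst := by positivity
  refine (norm_calR1_le_two_mul a M Y N Q R Q₀ β γ H).trans ?_
  rw [calR1plus_eq_sum a M Y N hQ0.le R Q₀ β γ H, mul_assoc]
  refine mul_le_mul_of_nonneg_left ?_ (by norm_num)
  refine (norm_sum_le _ _).trans ?_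
  calc ∑ q₀ ∈ Finset.Icc 1 ⌊Q₀⌋₊, ‖calR1q a M Y N Q R Q₀ β γ H q₀‖
      ≤ ∑ q₀ ∈ Finset.Icc 1 ⌊Q₀⌋₊, ((2 * M + Y) * q₀ / (Q * R)) * Cst := by
        refine Finset.sum_le_sum fun q₀ hq₀ => ?_
        rw [Finset.mem_Icc] at hq₀
        have hq₀Q : (q₀ : ℝ) ≤ Q₀ := by
          have := Nat.floor_le hQ₀
          exact le_trans (by exact_mod_cast hq₀.2) this
        exact norm_calR1q_le hY hYM hN hQ hR hTγ hγ hτ0 hτ hq₀.1 hq₀Q β H hE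
    _ = ((2 * M + Y) / (Q * R) * Cst) * ∑ q₀ ∈ Finset.Icc 1 ⌊Q₀⌋₊, (q₀ : ℝ) := by
        rw [Finset.mul_sum]
        refine Finset.sum_congr rfl fun q₀ _ => ?_
        ring
    _ ≤ ((2 * M + Y) / (Q * R) * Cst) * Q₀ ^ 2 := by
        refine mul_le_mul_of_nonneg_left ?_ (by positivity)
        calc ∑ q₀ ∈ Finset.Icc 1 ⌊Q₀⌋₊, (q₀ : ℝ) ≤ ∑ q₀ ∈ Finset.Icc 1 ⌊Q₀⌋₊, (⌊Q₀⌋₊ : ℝ) :=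
              Finset.sum_le_sum fun q₀ hq₀ => by exact_mod_cast (Finset.mem_Icc.1 hq₀).2
          _ = (⌊Q₀⌋₊ : ℝ) * ⌊Q₀⌋₊ := by
              rw [Finset.sum_const, Nat.card_Icc, Nat.add_sub_cancel, nsmul_eq_mul]
          _ ≤ Q₀ ^ 2 := by
              rw [sq]
              have := Nat.floor_le hQ₀
              exact mul_le_mul this this (by positivity) hQ₀
    _ = _ := by ring

end BFI

end Literature.NumberTheory.Sieve
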